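import Literature.MathematicalPhysics.QuantumFieldTheory.LatticeMaxwellMultiscale
import Literature.MathematicalPhysics.QuantumFieldTheory.ChatterjeeGaussianFactorisation
import HarnessLib

/-!
# Lattice Maxwell theory: the infinite-volume limit of the free energy (Theorem 15.2)

S. Chatterjee, *The leading term of the Yang–Mills free energy*, J. Funct. Anal. 271 (2016),
arXiv:1602.01222, §15, **Theorem 15.2**: the free energy per site `log Z_M(B_n)/n^d` of the
axial-gauge lattice Maxwell theory (`Z_M(B_n) = ChatterjeeAssembly.ZM n`, the Gaussian integral of
the comb-pinned Maxwell form of `LatticeMaxwellGaussian`) converges as `n → ∞`: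

* `tendsto_logZM_div (hd : 1 ≤ d) : ∃ L, Tendsto (fun n => logZM d n / n^d) atTop (𝓝 L)`.

This is the last analytic input of the printed proof of Theorem 2.1 (the named fact
`Literature.MathematicalPhysics.QuantumFieldTheory.chatterjee_freeEnergy`; the joint limit modulo this
theorem is `ChatterjeeJointLimit.tendsto_freeEnergyPerSite_of_tendsto_logZM`). Everything is proved;
no named fact is introduced.

## The argument

We follow the architecture of the printed §15 (comparison of `Z_M(B_n)` for `n = r(m-1)+1` with the
`r^d`-th power of a partition function of `B_m`, Cauchy property along `2^k + 1`, common refinements)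
but replace the printed restricted partition functions `Z'_M`, `Z_{M,m}` (Lemmas 15.3, 15.4) by an
*exact Gaussian elimination* of the block interiors, which the block machinery of
`LatticeMaxwellGaussian`/`LatticeMaxwellMultiscale` (Theorem 14.3) makes available:

* **Separable structure** (`formM_mkC_eq`). Fix the values `u` on the block-boundary free edges
  `A` (`Abdry`, the predicate `Pbd`). A plaquette touches the interior of at most one block
  (`touches_unique`, from the sixteen-case `blk_eq_of_edges`), so the Maxwell form is separably
  additive in the block interiors (`cq_sub_eq_sum`, `formM_sub_eq_sum`); with the form
  decomposition `formM_amb_add_eq` and the completed square `formM_eq_sq` of each block,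
  `M(u, s) = Φ(u) + Σ_β (s_β - μ_β(u))ᵀ Q_β (s_β - μ_β(u))` (`Phi`, `mubl`, `Qbl`).
* **Factorisation** (`ZM_fine_eq`): `Z_M(B_n) = Y · Z₀^{r^d}`, `Y = ∫ e^{-Φ(u)/2} du` (`Yint`),
  `Z₀` the Gaussian integral of one block (`Z0`): Fubini over `(u, s)` (`lintegral_split`), the
  index equivalence `{interior free edges} ≃ blocks × F₀` (`Ψ`, from `eqv` and the translations
  `σb`; all block precision matrices are reindexings of one another, `Qmat_eq_submatrix`,
  `gaussZ_Qmat_eq`), currying (`volume_preserving_curry`), the product formula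
  `lintegral_fintype_prod_eq_prod` and translation invariance.
* **Bounds for `Y`** (`Yint_le`, `le_Yint`): `Φ(u) ≥ c_n‖u‖²` (`le_Phi`, via the minimising
  interior `sStar`) and `Φ(u) ≤ M(u,0) ≤ C_n‖u‖²`; hence `|log Y| ≤ |A| L(n)` with
  `L(n) = O(log n)` (`abs_log_Yint_le`, `Lc`), and since `fineN m 1 = m` has the same `Z₀`,
  `|log Z_M(B_n) - r^d log Z_M(B_m)| ≤ 4d²(1+2^d) n^d L(n)/(m-1)` (`abs_logZM_sub_le`, using
  `|A| ≤ 4d²n^d/(m-1)`, `card_Abdry_le_real`) — the content of Lemmas 15.3–15.4.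
* **Lemma 15.1** (`abs_logZM_le`: `|log Z_M(B_n)| ≤ d n^d L(n)`, from `gaussZ_le`/`le_gaussZ`),
  the consistency estimate `abs_fM_sub_le` (`|f(n) - f(m)| ≤ C L(n)/(m-1)`), the Cauchy dyadic
  subsequence (`abs_fM_dyadic_le`, `exists_tendsto_fM_dyadic`) and the common refinement
  `(l-1)2^k + 1` (`abs_fM_sub_dyadic_le`) give the theorem exactly as printed.

## References

* S. Chatterjee, *The leading term of the Yang–Mills free energy*, J. Funct. Anal. 271 (2016)
  2944–3005, arXiv:1602.01222, §15 (Lemma 15.1, Lemmas 15.3–15.4, Theorem 15.2 and its proof),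
  §13 (the forms `M_{E,θ,n}`), Thm. 14.3 (proof: the blocks). [arXiv160201222]
-/

noncomputable section

open MeasureTheory Measure ProbabilityTheory Finset Matrix WithLp Filter Topology
open scoped ENNReal NNReal
open Literature.Probability.LatticeModels Literature.MathematicalPhysics.QuantumLattice

namespace Literature.MathematicalPhysics.QuantumFieldTheory

namespace LatticeMaxwell

open AxialGauge WilsonWeakCoupling GaussianToolkit ChatterjeeAssembly

variable {d : ℕ}

/-- Sites of `ℤ^d`. -/
local notation "ZSite" => Literature.Probability.LatticeModels.Site

/-! ### Measure plumbing: currying, reindexing, splitting -/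

section Plumbing

/-- **Currying preserves Lebesgue measure**: `(B × F → ℝ) ≃ (B → F → ℝ)` is volume preserving
for finite `B`, `F`. [folklore] -/
theorem volume_preserving_curry (B F : Type*) [Fintype B] [Fintype F] :
    MeasurePreserving (MeasurableEquiv.curry B F ℝ) volume volume := by
  classical
  refine ⟨(MeasurableEquiv.curry B F ℝ).measurable, ?_⟩
  symm
  refine Measure.pi_eq_generateFrom
    (C := fun _ : B => Set.pi Set.univ '' Set.pi Set.univ fun _ : F => {s : Set ℝ | MeasurableSet s})
    (fun _ => generateFrom_pi) (fun _ => isPiSystem_pi)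
    (fun _ => FiniteSpanningSetsIn.pi fun _ : F => (volume : Measure ℝ).toFiniteSpanningSetsIn) ?_
  intro s hs
  choose t ht hts using fun b => hs b
  have hst : ∀ b, s b = Set.pi Set.univ (t b) := fun b => (hts b).symm
  rw [MeasurableEquiv.map_apply]
  have hpre : (MeasurableEquiv.curry B F ℝ) ⁻¹' Set.pi Set.univ s =
      Set.pi Set.univ fun p : B × F => t p.1 p.2 := by
    ext x
    simp only [Set.mem_preimage, Set.mem_univ_pi, hst, MeasurableEquiv.coe_curry, Function.curry_apply,
      Prod.forall]
  rw [hpre, volume_pi_pi, Fintype.prod_prod_type]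
  refine Finset.prod_congr rfl fun b _ => ?_
  rw [hst b, Measure.pi_pi]

variable {ι κ : Type*} [Fintype ι] [Fintype κ]

/-- **Reindexing invariance of the Gaussian integral**: `Z_{Q∘σ} = Z_Q` for a bijection `σ`. [folklore] -/
theorem gaussZ_submatrix (Q : Matrix κ κ ℝ) (σ : ι ≃ κ) : gaussZ (Q.submatrix σ σ) = gaussZ Q := by
  set L := LinearIsometryEquiv.piLpCongrLeft 2 ℝ ℝ σ with hL
  have hmp : MeasurePreserving L volume volume := L.measurePreserving
  have hw : ∀ y : EuclideanSpace ℝ ι, gaussWeight (Q.submatrix σ σ) y = gaussWeight Q (L y) := by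
    intro y
    have hLy : ofLp (L y) = ofLp y ∘ σ.symm := by
      funext k
      rw [Function.comp_apply, hL, LinearIsometryEquiv.piLpCongrLeft_apply, Equiv.piCongrLeft'_apply]
    have key : ofLp y ⬝ᵥ (Q.submatrix σ σ) *ᵥ ofLp y = (ofLp y ∘ σ.symm) ⬝ᵥ Q *ᵥ (ofLp y ∘ σ.symm) := by
      rw [Matrix.submatrix_mulVec_equiv]
      simp only [dotProduct, Function.comp_apply]
      exact Fintype.sum_equiv σ _ _ (fun i => by simp)
    simp only [gaussWeight, hLy, key]
  unfold gaussZ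
  simp_rw [hw]
  exact hmp.lintegral_comp_emb L.toHomeomorph.toMeasurableEquiv.measurableEmbedding _

/-- **Lower bound for the Gaussian integral from an upper form bound**: if `yᵀPy ≤ C‖y‖²` (`C > 0`)
then `Z_P ≥ (2π/C)^{|ι|/2}`. [folklore] -/
theorem le_gaussZ [DecidableEq ι] {P : Matrix ι ι ℝ} {C : ℝ} (hC : 0 < C)
    (hup : ∀ v : ι → ℝ, v ⬝ᵥ P *ᵥ v ≤ C * ‖(WithLp.toLp 2 v : EuclideanSpace ℝ ι)‖ ^ 2) :
    ENNReal.ofReal ((Real.sqrt (2 * Real.pi) / Real.sqrt C) ^ Fintype.card ι) ≤ gaussZ P := by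
  have hsc : 0 < Real.sqrt C := Real.sqrt_pos.2 hC
  have h1 : ∀ y : EuclideanSpace ℝ ι, ENNReal.ofReal (Real.exp (-‖Real.sqrt C • y‖ ^ 2 / 2)) ≤ gaussWeight P y := by
    intro y
    apply ENNReal.ofReal_le_ofReal
    apply Real.exp_le_exp.2
    rw [norm_smul, mul_pow, Real.norm_eq_abs, abs_of_pos hsc, Real.sq_sqrt hC.le]
    have := hup (ofLp y)
    simp only [toLp_ofLp] at this
    linarith
  calc ENNReal.ofReal ((Real.sqrt (2 * Real.pi) / Real.sqrt C) ^ Fintype.card ι)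
      = ENNReal.ofReal |(Real.sqrt C ^ Module.finrank ℝ (EuclideanSpace ℝ ι))⁻¹| *
          ∫⁻ y : EuclideanSpace ℝ ι, ENNReal.ofReal (Real.exp (-‖y‖ ^ 2 / 2)) := by
        rw [lintegral_exp_neg_norm_sq_div_two, finrank_euclideanSpace, ← ENNReal.ofReal_mul (abs_nonneg _),
          abs_of_pos (by positivity), div_pow, inv_mul_eq_div]
    _ = ∫⁻ y : EuclideanSpace ℝ ι, ENNReal.ofReal (Real.exp (-‖Real.sqrt C • y‖ ^ 2 / 2)) :=
        (lintegral_comp_smul volume (fun y : EuclideanSpace ℝ ι => ENNReal.ofReal (Real.exp (-‖y‖ ^ 2 / 2))) hsc.ne').symm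
    _ ≤ gaussZ P := lintegral_mono h1

/-- **Splitting an integral over `ι → ℝ` along a decidable predicate** (Fubini for
`piEquivPiSubtypeProd`): first the `P`-coordinates `u`, inside the others `s`. [folklore] -/
theorem lintegral_split (P : ι → Prop) [DecidablePred P] {f : (ι → ℝ) → ℝ≥0∞} (hf : Measurable f) :
    ∫⁻ t, f t = ∫⁻ u : {i // P i} → ℝ, ∫⁻ s : {i // ¬ P i} → ℝ,
      f ((MeasurableEquiv.piEquivPiSubtypeProd (fun _ : ι => ℝ) P).symm (u, s)) := by
  set e := MeasurableEquiv.piEquivPiSubtypeProd (fun _ : ι => ℝ) P with he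
  have hmp : MeasurePreserving e.symm ((volume : Measure ({i // P i} → ℝ)).prod volume) volume :=
    (volume_preserving_piEquivPiSubtypeProd (fun _ : ι => ℝ) P).symm
  rw [← hmp.lintegral_comp_emb e.symm.measurableEmbedding]
  exact lintegral_prod _ (hf.comp e.symm.measurable).aemeasurable

end Plumbing


/-! ### Translation between blocks: all block precision matrices have the same Gaussian integral -/

section Translate

variable {m : ℕ}

/-- Shifting a vertex by a difference of block corners does not change whether it touches the grid. [folklore] -/
theorem touch_add_corner_sub_iff (b c : Fin d → ℤ) (x : ZSite d) :
    Touch m (x + (corner m c - corner m b)) ↔ Touch m x := by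
  unfold Touch
  constructor
  · rintro ⟨k, hk⟩
    refine ⟨k, ?_⟩
    simp only [Pi.add_apply, Pi.sub_apply, corner] at hk
    have : x k = (x k + (c k * bM m - b k * bM m)) - (c k - b k) * bM m := by ring
    rw [this]; exact dvd_sub hk (dvd_mul_left _ _)
  · rintro ⟨k, hk⟩
    refine ⟨k, ?_⟩
    simp only [Pi.add_apply, Pi.sub_apply, corner]
    exact dvd_add hk (dvd_sub (dvd_mul_left _ _) (dvd_mul_left _ _))

/-- `IsBdry` is invariant under shifts by differences of block corners. [folklore] -/
theorem isBdry_shift_iff (b c : Fin d → ℤ) (e : ZdEdge d) :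
    IsBdry m (shiftE (corner m c - corner m b) e) ↔ IsBdry m e := by
  unfold IsBdry
  simp only [shiftE_apply]
  rw [add_right_comm, touch_add_corner_sub_iff, touch_add_corner_sub_iff]

/-- For a non-boundary edge, being a comb edge only depends on the direction (it must be the last). [folklore] -/
theorem isComb_iff_of_not_isBdry {e : ZdEdge d} (he : ¬ IsBdry m e) : IsComb e ↔ ∀ k, ¬ e.2 < k := by
  constructor
  · intro hc k hk
    apply he
    left
    exact ⟨k, by rw [hc k hk]; exact dvd_zero _⟩
  · intro h k hk; exact absurd hk (h k)

/-- Shifting block edges to another block. [folklore] -/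
theorem shiftE_mem_boxEdgesAt_corner {b c : Fin d → ℤ} {e : ZdEdge d} (he : e ∈ boxEdgesAt (corner m b) m) :
    shiftE (corner m c - corner m b) e ∈ boxEdgesAt (corner m c) m := by
  rw [mem_boxEdgesAt] at he ⊢
  have : (e.1 + (corner m c - corner m b) - corner m c, e.2) = (e.1 - corner m b, e.2) := by
    ext1
    · simp only; abel
    · rfl
  rw [shiftE_apply, this]; exact he

/-- **The pinned predicates of two blocks correspond under translation** (on block edges). [folklore] -/
theorem pinB_shift_iff (hm : 2 ≤ m) {b c : Fin d → ℤ} {e : ZdEdge d} (he : e ∈ boxEdgesAt (corner m b) m) :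
    pinB m c (shiftE (corner m c - corner m b) e) ↔ pinB m b e := by
  have he' := shiftE_mem_boxEdgesAt_corner (c := c) he
  by_cases hB : IsBdry m e
  · have hB' := (isBdry_shift_iff b c e).2 hB
    exact ⟨fun _ => Or.inr (Or.inl hB), fun _ => Or.inr (Or.inl hB')⟩
  · have hB' : ¬ IsBdry m (shiftE (corner m c - corner m b) e) := fun h => hB ((isBdry_shift_iff b c e).1 h)
    have hblk := blk_eq_of_mem_of_not_isBdry hm he hB
    have hblk' := blk_eq_of_mem_of_not_isBdry hm he' hB'
    have hc1 : IsComb (shiftE (corner m c - corner m b) e) ↔ IsComb e := by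
      rw [isComb_iff_of_not_isBdry hB, isComb_iff_of_not_isBdry hB']; rfl
    unfold pinB
    rw [hc1]
    constructor
    · rintro (h | h | h)
      · exact Or.inl h
      · exact absurd h hB'
      · exact absurd hblk' h
    · rintro (h | h | h)
      · exact Or.inl h
      · exact absurd h hB
      · exact absurd hblk h

/-- **The translation equivalence between the free edges of two blocks.** [folklore] -/
def σb (hm : 2 ≤ m) (b c : Fin d → ℤ) : Free (pinB m b) (corner m b) m ≃ Free (pinB m c) (corner m c) m where
  toFun e := ⟨⟨shiftE (corner m c - corner m b) e.1.1, shiftE_mem_boxEdgesAt_corner e.1.2⟩, by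
    rw [pinB_shift_iff hm e.1.2]; exact e.2⟩
  invFun e := ⟨⟨shiftE (corner m b - corner m c) e.1.1, shiftE_mem_boxEdgesAt_corner e.1.2⟩, by
    rw [pinB_shift_iff hm e.1.2]; exact e.2⟩
  left_inv e := by
    apply Subtype.ext; apply Subtype.ext
    simp only [shiftE_apply]
    ext1
    · simp only; abel
    · rfl
  right_inv e := by
    apply Subtype.ext; apply Subtype.ext
    simp only [shiftE_apply]
    ext1
    · simp only; abel
    · rfl

/-- `σb e` as an edge. [folklore] -/
@[simp] theorem σb_apply_val (hm : 2 ≤ m) (b c : Fin d → ℤ) (e : Free (pinB m b) (corner m b) m) :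
    ((σb hm b c e).1.1 : ZdEdge d) = shiftE (corner m c - corner m b) e.1.1 := rfl

/-- The edge coefficients are translation invariant. [folklore] -/
theorem coeffAux_shift (v : ZSite d) (e : ZdEdge d) (q : Plaq d) :
    coeffAux (shiftE v e) (Plaq.shift v q) = coeffAux e q := by
  have key : ∀ (x y : ZSite d) (i j : Fin d), ((x + v, i) = (y + v, j)) ↔ ((x, i) = (y, j)) := by
    intro x y i j
    constructor
    · intro h
      have h1 := congrArg Prod.fst h
      have h2 := congrArg Prod.snd h
      exact Prod.ext (add_right_cancel h1) h2
    · intro h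
      rw [Prod.mk.injEq] at h
      rw [h.1, h.2]
  obtain ⟨x, i⟩ := e
  unfold coeffAux
  simp only [shiftE_apply, Plaq.shift_fst, Plaq.shift_snd, add_right_comm q.1 v (Pi.single q.2.1 1),
    add_right_comm q.1 v (Pi.single q.2.2 1), key]

/-- The coefficient vectors of the two blocks correspond under `σb`. [folklore] -/
theorem coeff_σb (hm : 2 ≤ m) (b c : Fin d → ℤ) (p : Plaq d) (e : Free (pinB m b) (corner m b) m) :
    coeff (pinB m c) (corner m c) m (Plaq.shift (corner m c) p) (σb hm b c e) =
      coeff (pinB m b) (corner m b) m (Plaq.shift (corner m b) p) e := by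
  simp only [coeff, σb_apply_val]
  have : Plaq.shift (corner m c) p = Plaq.shift (corner m c - corner m b) (Plaq.shift (corner m b) p) := by
    refine Prod.ext ?_ rfl
    simp only [Plaq.shift_fst]; abel
  rw [this, coeffAux_shift]

/-- **The precision matrices of two blocks are reindexings of each other.** [folklore] -/
theorem Qmat_eq_submatrix (hm : 2 ≤ m) (b c : Fin d → ℤ) :
    Qmat (pinB m c) (corner m c) m = (Qmat (pinB m b) (corner m b) m).submatrix (σb hm b c).symm (σb hm b c).symm := by
  ext i j
  simp only [Qmat, Matrix.sum_apply, Matrix.submatrix_apply, vecMulVec_apply]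
  refine Finset.sum_congr rfl fun p _ => ?_
  rw [← coeff_σb hm b c p ((σb hm b c).symm i), ← coeff_σb hm b c p ((σb hm b c).symm j),
    Equiv.apply_symm_apply, Equiv.apply_symm_apply]

/-- **All blocks have the same Gaussian integral.** [folklore] -/
theorem gaussZ_Qmat_eq (hm : 2 ≤ m) (b c : Fin d → ℤ) :
    gaussZ (Qmat (pinB m c) (corner m c) m) = gaussZ (Qmat (pinB m b) (corner m b) m) := by
  rw [Qmat_eq_submatrix hm b c, gaussZ_submatrix]

/-- The homogeneous block forms correspond under `σb`: `M_c(s ∘ σ⁻¹) = M_b(s)`. [folklore] -/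
theorem formM_σb (hm : 2 ≤ m) (b c : Fin d → ℤ) (s : Free (pinB m b) (corner m b) m → ℝ) :
    formM (pinB m c) (corner m c) m 0 (s ∘ (σb hm b c).symm) = formM (pinB m b) (corner m b) m 0 s := by
  have hs : (s ∘ (σb hm b c).symm) ∘ (σb hm b c).symm.symm = s := by
    funext e; simp
  rw [← dotProduct_Qmat_mulVec, ← dotProduct_Qmat_mulVec, Qmat_eq_submatrix hm b c, Matrix.submatrix_mulVec_equiv, hs]
  simp only [dotProduct, Function.comp_apply]
  exact Fintype.sum_equiv (σb hm b c).symm _ _ fun i => rfl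

end Translate


/-! ### Plaquettes touch at most one block; the interior free edges as `blocks × local edges` -/

section Geometry

variable {m r : ℕ}

/-- Adjacent non-touching vertices have the same block index. [folklore] -/
theorem blk_add_single_of_not_touch (hm : 2 ≤ m) {x : ZSite d} (k : Fin d) (hx : ¬ Touch m x)
    (hxk : ¬ Touch m (x + Pi.single k 1)) : blk m (x + Pi.single k 1) = blk m x :=
  blk_add_single hm (e := (x, k)) (by unfold IsBdry; push Not; exact ⟨hx, hxk⟩)

/-- **Two non-boundary edges of one plaquette have sources in the same block** (16 cases). [folklore] -/
theorem blk_eq_of_edges (hm : 2 ≤ m) {q : Plaq d} {e e' : ZdEdge d} (he : ¬ IsBdry m e) (he' : ¬ IsBdry m e')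
    (hqe : (q.1, q.2.1) = e ∨ (q.1 + Pi.single q.2.1 1, q.2.2) = e ∨
      (q.1 + Pi.single q.2.2 1, q.2.1) = e ∨ (q.1, q.2.2) = e)
    (hqe' : (q.1, q.2.1) = e' ∨ (q.1 + Pi.single q.2.1 1, q.2.2) = e' ∨
      (q.1 + Pi.single q.2.2 1, q.2.1) = e' ∨ (q.1, q.2.2) = e') :
    blk m e.1 = blk m e'.1 := by
  have hb := blk_add_single hm he
  have hb' := blk_add_single hm he'
  have hn := he; have hn' := he'
  simp only [IsBdry, not_or] at hn hn'
  obtain ⟨x, i, j⟩ := q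
  have hcomm : x + Pi.single i (1 : ℤ) + Pi.single j 1 = x + Pi.single j 1 + Pi.single i 1 := add_right_comm _ _ _
  rcases hqe with h | h | h | h <;> rcases hqe' with h' | h' | h' | h' <;> subst h <;> subst h' <;>
    simp only at hb hb' hn hn' ⊢
  -- (A,B)
  · exact hb.symm
  -- (A,C)
  · exact (blk_add_single_of_not_touch hm j hn.1 hn'.1).symm
  -- (B,A)
  · exact hb'
  -- (B,C)
  · rw [← hb, ← hb', hcomm]
  -- (B,D)
  · exact blk_add_single_of_not_touch hm i hn'.1 hn.1
  -- (C,A)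
  · exact blk_add_single_of_not_touch hm j hn'.1 hn.1
  -- (C,B)
  · rw [← hb, ← hb', hcomm]
  -- (C,D)
  · exact hb'.symm ▸ (blk_add_single_of_not_touch hm j hn'.1 hn.1)
  -- (D,B)
  · exact (blk_add_single_of_not_touch hm i hn.1 hn'.1).symm
  -- (D,C)
  · exact hb.symm

/-- **A plaquette touches the interior of at most one block.** [folklore] -/
theorem touches_unique (hm : 2 ≤ m) {q : Plaq d} {b b' : Fin d → ℤ} (h : Touches m b q) (h' : Touches m b' q) :
    b = b' := by
  obtain ⟨e, ⟨he, hbe⟩, hqe⟩ := h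
  obtain ⟨e', ⟨he', hbe'⟩, hqe'⟩ := h'
  rw [← hbe, ← hbe', blk_eq_of_edges hm he he' hqe hqe']

/-- The reference block `0`. [folklore] -/
abbrev B0 (d : ℕ) : Fin d → ℤ := fun _ => 0

variable (m) in
/-- The free edges of the reference block: the common index type `F₀` of all block Gaussians. [folklore] -/
abbrev F₀ : Type := Free (pinB m (B0 d)) (corner m (B0 d)) m

/-- **The interior coordinates as `blocks × local edges`**: the map `(β, f) ↦` the ambient index of
the translate of the local edge `f` into block `β`. [folklore] -/
def toAmb (hm : 2 ≤ m) (β : Fin d → Fin r) (f : F₀ (d := d) m) : {i : Amb (d := d) m r // ¬ IsBdry m i.1.1} :=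
  ⟨((eqv hm (bz_valid β)).symm (σb hm (B0 d) (bz β) f)).1, ((eqv hm (bz_valid β)).symm (σb hm (B0 d) (bz β) f)).2.1⟩

/-- The underlying edge of `toAmb β f`. [folklore] -/
theorem toAmb_edge (hm : 2 ≤ m) (β : Fin d → Fin r) (f : F₀ (d := d) m) :
    ((toAmb (r := r) hm β f).1.1.1 : ZdEdge d) = shiftE (corner m (bz β) - corner m (B0 d)) f.1.1 := rfl

/-- The block of `toAmb β f` is `β`. [folklore] -/
theorem blk_toAmb (hm : 2 ≤ m) (β : Fin d → Fin r) (f : F₀ (d := d) m) :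
    blk m (toAmb (r := r) hm β f).1.1.1.1 = bz β :=
  ((eqv hm (bz_valid β)).symm (σb hm (B0 d) (bz β) f)).2.2

/-- `toAmb` is a bijection onto the interior free edges. [folklore] -/
theorem toAmb_bijective (hm : 2 ≤ m) :
    Function.Bijective (fun p : (Fin d → Fin r) × F₀ (d := d) m => toAmb (r := r) hm p.1 p.2) := by
  constructor
  · rintro ⟨β, f⟩ ⟨β', f'⟩ h
    simp only at h
    have hβ : β = β' := by
      apply bz_injective
      rw [← blk_toAmb hm β f, ← blk_toAmb hm β' f', h]
    subst hβ
    have hedge := congrArg (fun i : {i : Amb (d := d) m r // ¬ IsBdry m i.1.1} => (i.1.1.1 : ZdEdge d)) h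
    simp only [toAmb_edge] at hedge
    have hf : f = f' := by
      apply Subtype.ext; apply Subtype.ext
      exact (shiftE _).injective hedge
    rw [hf]
  · intro i
    set β := βof hm i.1 i.2 with hβ
    have hP : Pb m (bz β) i.1 := ⟨i.2, (bz_βof hm i.1 i.2).symm⟩
    refine ⟨(β, (σb hm (B0 d) (bz β)).symm (eqv hm (bz_valid β) ⟨i.1, hP⟩)), ?_⟩
    apply Subtype.ext
    show ((eqv hm (bz_valid β)).symm (σb hm (B0 d) (bz β) ((σb hm (B0 d) (bz β)).symm (eqv hm (bz_valid β) ⟨i.1, hP⟩)))).1 = i.1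
    rw [Equiv.apply_symm_apply, Equiv.symm_apply_apply]

/-- **The index equivalence** `{interior free edges} ≃ blocks × F₀`. [folklore] -/
def Ψ (hm : 2 ≤ m) : {i : Amb (d := d) m r // ¬ IsBdry m i.1.1} ≃ (Fin d → Fin r) × F₀ (d := d) m :=
  (Equiv.ofBijective _ (toAmb_bijective (r := r) hm)).symm

/-- `Ψ⁻¹ (β, f) = toAmb β f`. [folklore] -/
@[simp] theorem Ψ_symm_apply (hm : 2 ≤ m) (β : Fin d → Fin r) (f : F₀ (d := d) m) :
    (Ψ (r := r) hm).symm (β, f) = toAmb hm β f := rfl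

/-- The local coordinate of the ambient index `eqv⁻¹ e` of a free edge `e` of block `β`. [folklore] -/
theorem Ψ_eqv_symm (hm : 2 ≤ m) (β : Fin d → Fin r) (e : Free (pinB m (bz β)) (corner m (bz β)) m) :
    Ψ (r := r) hm ⟨((eqv hm (bz_valid β)).symm e).1, ((eqv hm (bz_valid β)).symm e).2.1⟩ =
      (β, (σb hm (B0 d) (bz β)).symm e) := by
  rw [Equiv.apply_eq_iff_eq_symm_apply, Ψ_symm_apply]
  apply Subtype.ext
  show ((eqv hm (bz_valid β)).symm e).1 = ((eqv hm (bz_valid β)).symm (σb hm (B0 d) (bz β) ((σb hm (B0 d) (bz β)).symm e))).1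
  rw [Equiv.apply_symm_apply]

end Geometry


/-! ### The separable structure of the Maxwell form given the block-boundary values -/

section Separable

variable {m r : ℕ}

variable (m r) in
/-- The boundary predicate on the free edges of the fine box. [cite: arXiv160201222, Thm. 14.3 (proof), the set `A`] -/
abbrev Pbd : Amb (d := d) m r → Prop := fun i => IsBdry m i.1.1

variable (m r) in
/-- The boundary/interior splitting of the ambient coordinates. [folklore] -/
abbrev splitBI := MeasurableEquiv.piEquivPiSubtypeProd (fun _ : Amb (d := d) m r => ℝ) (Pbd m r)

variable (m r) in
/-- The ambient configuration with boundary values `u` and interior values `s`. [folklore] -/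
abbrev mkC (u : {i : Amb (d := d) m r // Pbd m r i} → ℝ) (s : {i : Amb (d := d) m r // ¬ Pbd m r i} → ℝ) :
    Amb (d := d) m r → ℝ := (splitBI m r).symm (u, s)

/-- `mkC` at a boundary index. [folklore] -/
theorem mkC_apply_of_bd (u : {i : Amb (d := d) m r // Pbd m r i} → ℝ) (s : {i : Amb (d := d) m r // ¬ Pbd m r i} → ℝ)
    {i : Amb (d := d) m r} (hi : Pbd m r i) : mkC m r u s i = u ⟨i, hi⟩ := by
  simp [mkC, splitBI, MeasurableEquiv.piEquivPiSubtypeProd, Equiv.piEquivPiSubtypeProd_symm_apply, hi]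

/-- `mkC` at an interior index. [folklore] -/
theorem mkC_apply_of_not_bd (u : {i : Amb (d := d) m r // Pbd m r i} → ℝ) (s : {i : Amb (d := d) m r // ¬ Pbd m r i} → ℝ)
    {i : Amb (d := d) m r} (hi : ¬ Pbd m r i) : mkC m r u s i = s ⟨i, hi⟩ := by
  simp [mkC, splitBI, MeasurableEquiv.piEquivPiSubtypeProd, Equiv.piEquivPiSubtypeProd_symm_apply, hi]

/-- The configuration agreeing with `t` on the interior of block `b` and with `t'` elsewhere. [folklore] -/
def tblk (b : Fin d → ℤ) (t t' : Amb (d := d) m r → ℝ) : Amb (d := d) m r → ℝ :=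
  fun i => if Pb m b i then t i else t' i

/-- `tblk` on the interior of `b`. [folklore] -/
theorem tblk_of_pb {b : Fin d → ℤ} (t t' : Amb (d := d) m r → ℝ) {i : Amb (d := d) m r} (hi : Pb m b i) :
    tblk b t t' i = t i := by simp [tblk, hi]

/-- `tblk` off the interior of `b`. [folklore] -/
theorem tblk_of_not_pb {b : Fin d → ℤ} (t t' : Amb (d := d) m r → ℝ) {i : Amb (d := d) m r} (hi : ¬ Pb m b i) :
    tblk b t t' i = t' i := by simp [tblk, hi]

/-- The block values only read the interior of the block. [folklore] -/
theorem tB_congr (hm : 2 ≤ m) {b : Fin d → ℤ} (hb : ∀ k, 0 ≤ b k ∧ b k < r) {t t' : Amb (d := d) m r → ℝ}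
    (h : ∀ i, Pb m b i → t i = t' i) : tB hm hb t = tB hm hb t' := by
  funext e
  simp only [tB]
  exact h _ ((eqv hm hb).symm e).2

/-- The block values of a configuration vanishing on the interior vanish. [folklore] -/
theorem tB_mkC_zero (hm : 2 ≤ m) {b : Fin d → ℤ} (hb : ∀ k, 0 ≤ b k ∧ b k < r)
    (u : {i : Amb (d := d) m r // Pbd m r i} → ℝ) : tB hm hb (mkC m r u 0) = 0 := by
  funext e
  simp only [tB, Pi.zero_apply]
  rw [mkC_apply_of_not_bd u 0 ((eqv hm hb).symm e).2.1, Pi.zero_apply]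

/-- The homogeneous block form is nonnegative. [folklore] -/
theorem formM_nonneg {pin : ZdEdge d → Prop} [DecidablePred pin] {a : ZSite d} {n : ℕ} (θ : ZdEdge d → ℝ)
    (s : Free pin a n → ℝ) : 0 ≤ formM pin a n θ s := by
  unfold formM; exact Finset.sum_nonneg fun _ _ => sq_nonneg _

/-- **The per-block increment**: changing the interior of block `b` from `0` to the values of `t`
changes the Maxwell form by `(s_b - μ_b)ᵀQ_b(s_b - μ_b) - μ_bᵀQ_bμ_b`, where `s_b` are the block
values of `t` and `μ_b` the mean for the boundary values read from the reference configuration. [cite: arXiv160201222, §15 (proof of Thm. 15.2), §13] -/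
theorem formM_tblk_sub (hm : 2 ≤ m) {b : Fin d → ℤ} (hb : ∀ k, 0 ≤ b k ∧ b k < r) (t : Amb (d := d) m r → ℝ)
    (u : {i : Amb (d := d) m r // Pbd m r i} → ℝ) :
    formM pinI (0 : ZSite d) (fineN m r) 0 (tblk b t (mkC m r u 0)) - formM pinI (0 : ZSite d) (fineN m r) 0 (mkC m r u 0) =
      (tB hm hb t - mean (pinB m b) (corner m b) m (ambE (mkC m r u 0))) ⬝ᵥ
          Qmat (pinB m b) (corner m b) m *ᵥ (tB hm hb t - mean (pinB m b) (corner m b) m (ambE (mkC m r u 0))) -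
        mean (pinB m b) (corner m b) m (ambE (mkC m r u 0)) ⬝ᵥ
          Qmat (pinB m b) (corner m b) m *ᵥ mean (pinB m b) (corner m b) m (ambE (mkC m r u 0)) := by
  set t0 := mkC m r u 0 with ht0
  have h1 := formM_amb_add_eq hm hb (tblk b t t0) t0 (fun i hi => tblk_of_not_pb t t0 hi)
  have h2 := formM_amb_add_eq hm hb t0 t0 (fun _ _ => rfl)
  have htB : tB hm hb (tblk b t t0) = tB hm hb t := tB_congr hm hb fun i hi => tblk_of_pb t t0 hi
  have htB0 : tB hm hb t0 = 0 := tB_mkC_zero hm hb u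
  rw [htB] at h1
  rw [htB0] at h2
  set θ := ambE t0
  have hsq1 := formM_eq_sq (pin := pinB m b) (a := corner m b) (n := m) (hpinB b) θ (tB hm hb t)
  have hsq0 := formM_eq_sq (pin := pinB m b) (a := corner m b) (n := m) (hpinB b) θ 0
  rw [zero_sub, neg_dotProduct, Matrix.mulVec_neg, dotProduct_neg, neg_neg] at hsq0
  linarith

/-- Being one of the four edges of a plaquette. [folklore] -/
abbrev IsEdgeOf (q : Plaq d) (e : ZdEdge d) : Prop :=
  (q.1, q.2.1) = e ∨ (q.1 + Pi.single q.2.1 1, q.2.2) = e ∨ (q.1 + Pi.single q.2.2 1, q.2.1) = e ∨ (q.1, q.2.2) = e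

/-- A plaquette with an interior free edge touches the block of that edge. [folklore] -/
theorem touches_of_interior (hm : 2 ≤ m) (i : Amb (d := d) m r) (hi : ¬ IsBdry m i.1.1) {q : Plaq d}
    (hq : IsEdgeOf q i.1.1) : Touches m (bz (βof hm i hi)) q :=
  ⟨i.1.1, ⟨hi, (bz_βof hm i hi).symm⟩, hq⟩

/-- An interior free edge of a plaquette touching block `b` is an interior edge of `b`. [folklore] -/
theorem pb_of_touches (hm : 2 ≤ m) {b : Fin d → ℤ} {q : Plaq d} (hq : Touches m b q) (i : Amb (d := d) m r)
    (hi : ¬ IsBdry m i.1.1) (hiq : IsEdgeOf q i.1.1) : Pb m b i := by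
  obtain ⟨e, ⟨he, hbe⟩, hqe⟩ := hq
  exact ⟨hi, by rw [← hbe]; exact blk_eq_of_edges hm hi he hiq hqe⟩

/-- **Per-plaquette separable additivity**: the increment of a plaquette cost from zero interior to
the interior values `s` is the sum over blocks of the single-block increments (a plaquette touches
at most one block; untouched plaquettes only read boundary values). [folklore] -/
theorem cq_sub_eq_sum (hm : 2 ≤ m) (u : {i : Amb (d := d) m r // Pbd m r i} → ℝ)
    (s : {i : Amb (d := d) m r // ¬ Pbd m r i} → ℝ) (q : Plaq d) :
    cq (mkC m r u s) q - cq (mkC m r u 0) q =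
      ∑ β : Fin d → Fin r, (cq (tblk (bz β) (mkC m r u s) (mkC m r u 0)) q - cq (mkC m r u 0) q) := by
  set t := mkC m r u s with ht
  set t0 := mkC m r u 0 with ht0
  have hagree : ∀ i, Pbd m r i → t i = t0 i := fun i hi => by
    rw [ht, ht0, mkC_apply_of_bd u s hi, mkC_apply_of_bd u 0 hi]
  by_cases hex : ∃ β : Fin d → Fin r, Touches m (bz β) q
  · obtain ⟨β₀, hβ₀⟩ := hex
    have huniq : ∀ β, Touches m (bz β) q → β = β₀ := fun β hβ => bz_injective (touches_unique hm hβ hβ₀)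
    rw [Finset.sum_eq_single β₀]
    · congr 1
      refine cq_congr t (tblk (bz β₀) t t0) q fun i hiq => ?_
      by_cases hP : Pb m (bz β₀) i
      · rw [tblk_of_pb _ _ hP]
      · rw [tblk_of_not_pb _ _ hP]
        have hbd : Pbd m r i := by
          by_contra hnb
          exact hP (pb_of_touches hm hβ₀ i hnb hiq)
        exact hagree i hbd
    · intro β _ hne
      rw [sub_eq_zero]
      exact cq_eq_of_not_touches _ _ (fun i hi => tblk_of_not_pb _ _ hi) (fun h => hne (huniq β h))
    · intro h; exact absurd (Finset.mem_univ β₀) h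
  · push Not at hex
    have h0 : ∀ β : Fin d → Fin r, cq (tblk (bz β) t t0) q - cq t0 q = 0 := fun β => by
      rw [sub_eq_zero]
      exact cq_eq_of_not_touches _ _ (fun i hi => tblk_of_not_pb _ _ hi) (hex β)
    rw [Finset.sum_eq_zero (fun β _ => h0 β), sub_eq_zero]
    refine cq_congr t t0 q fun i hiq => ?_
    have hbd : Pbd m r i := by
      by_contra hnb
      exact hex (βof hm i hnb) (touches_of_interior hm i hnb hiq)
    exact hagree i hbd

/-- **Separable additivity of the Maxwell form given the boundary values.** [folklore] -/
theorem formM_sub_eq_sum (hm : 2 ≤ m) (u : {i : Amb (d := d) m r // Pbd m r i} → ℝ)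
    (s : {i : Amb (d := d) m r // ¬ Pbd m r i} → ℝ) :
    formM pinI (0 : ZSite d) (fineN m r) 0 (mkC m r u s) - formM pinI (0 : ZSite d) (fineN m r) 0 (mkC m r u 0) =
      ∑ β : Fin d → Fin r, (formM pinI (0 : ZSite d) (fineN m r) 0 (tblk (bz β) (mkC m r u s) (mkC m r u 0)) -
        formM pinI (0 : ZSite d) (fineN m r) 0 (mkC m r u 0)) := by
  have hrw : ∀ t t' : Amb (d := d) m r → ℝ,
      formM pinI (0 : ZSite d) (fineN m r) 0 t - formM pinI (0 : ZSite d) (fineN m r) 0 t' =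
        ∑ q ∈ plaquettesIn (halfOpenBox d (fineN m r)), (cq t q - cq t' q) := fun t t' => by
    rw [formM_amb, formM_amb, ← Finset.sum_sub_distrib]
  rw [hrw]
  simp only [hrw]
  rw [Finset.sum_comm]
  exact Finset.sum_congr rfl fun q _ => cq_sub_eq_sum hm u s q

variable (m) in
/-- The precision matrix of block `β`. [cite: arXiv160201222, §13] -/
abbrev Qbl (β : Fin d → Fin r) : Matrix (Free (pinB m (bz β)) (corner m (bz β)) m) (Free (pinB m (bz β)) (corner m (bz β)) m) ℝ :=
  Qmat (pinB m (bz β)) (corner m (bz β)) m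

/-- The mean of block `β` for the boundary values `u` (interior zero elsewhere). [cite: arXiv160201222, Thm. 14.2 (proof)] -/
abbrev mubl (u : {i : Amb (d := d) m r // Pbd m r i} → ℝ) (β : Fin d → Fin r) :
    Free (pinB m (bz β)) (corner m (bz β)) m → ℝ :=
  mean (pinB m (bz β)) (corner m (bz β)) m (ambE (mkC m r u 0))

/-- The effective boundary form `Φ(u) = M(u, 0) - Σ_β μ_βᵀ Q_β μ_β` (the minimum of the Maxwell form
over the interiors). [cite: arXiv160201222, §15] -/
def Phi (u : {i : Amb (d := d) m r // Pbd m r i} → ℝ) : ℝ :=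
  formM pinI (0 : ZSite d) (fineN m r) 0 (mkC m r u 0) - ∑ β : Fin d → Fin r, mubl u β ⬝ᵥ Qbl m β *ᵥ mubl u β

/-- **The separable structure**: `M(u, s) = Φ(u) + Σ_β (s_β - μ_β(u))ᵀ Q_β (s_β - μ_β(u))`. [cite: arXiv160201222, §15 (proof of Thm. 15.2)] -/
theorem formM_mkC_eq (hm : 2 ≤ m) (u : {i : Amb (d := d) m r // Pbd m r i} → ℝ)
    (s : {i : Amb (d := d) m r // ¬ Pbd m r i} → ℝ) :
    formM pinI (0 : ZSite d) (fineN m r) 0 (mkC m r u s) =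
      Phi u + ∑ β : Fin d → Fin r,
        (tB hm (bz_valid β) (mkC m r u s) - mubl u β) ⬝ᵥ Qbl m β *ᵥ (tB hm (bz_valid β) (mkC m r u s) - mubl u β) := by
  have h := formM_sub_eq_sum hm u s
  have hβ : ∀ β : Fin d → Fin r,
      formM pinI (0 : ZSite d) (fineN m r) 0 (tblk (bz β) (mkC m r u s) (mkC m r u 0)) -
        formM pinI (0 : ZSite d) (fineN m r) 0 (mkC m r u 0) =
      (tB hm (bz_valid β) (mkC m r u s) - mubl u β) ⬝ᵥ Qbl m β *ᵥ (tB hm (bz_valid β) (mkC m r u s) - mubl u β) -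
        mubl u β ⬝ᵥ Qbl m β *ᵥ mubl u β := fun β =>
    formM_tblk_sub hm (bz_valid β) (mkC m r u s) u
  simp only [hβ, Finset.sum_sub_distrib] at h
  unfold Phi
  linarith

/-- **The minimising interior**: the interior values making every block attain its mean. [folklore] -/
def sStar (hm : 2 ≤ m) (u : {i : Amb (d := d) m r // Pbd m r i} → ℝ) : {i : Amb (d := d) m r // ¬ Pbd m r i} → ℝ :=
  fun i => mubl u (Ψ hm i).1 (σb hm (B0 d) (bz (Ψ hm i).1) (Ψ hm i).2)

/-- The block values of a configuration are its interior values read through `Ψ`. [folklore] -/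
theorem tB_mkC (hm : 2 ≤ m) (u : {i : Amb (d := d) m r // Pbd m r i} → ℝ)
    (s : {i : Amb (d := d) m r // ¬ Pbd m r i} → ℝ) (β : Fin d → Fin r)
    (e : Free (pinB m (bz β)) (corner m (bz β)) m) :
    tB hm (bz_valid β) (mkC m r u s) e = s ((Ψ hm).symm (β, (σb hm (B0 d) (bz β)).symm e)) := by
  rw [tB, mkC_apply_of_not_bd u s ((eqv hm (bz_valid β)).symm e).2.1]
  congr 1
  rw [Equiv.eq_symm_apply, Ψ_eqv_symm]

/-- The block values of the minimising configuration are the block means. [folklore] -/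
theorem tB_sStar (hm : 2 ≤ m) (u : {i : Amb (d := d) m r // Pbd m r i} → ℝ) (β : Fin d → Fin r) :
    tB hm (bz_valid β) (mkC m r u (sStar hm u)) = mubl u β := by
  funext e
  rw [tB_mkC, sStar, Equiv.apply_symm_apply, Equiv.apply_symm_apply]

/-- `Φ(u) ≤ M(u, 0)`. [folklore] -/
theorem Phi_le (u : {i : Amb (d := d) m r // Pbd m r i} → ℝ) :
    Phi u ≤ formM pinI (0 : ZSite d) (fineN m r) 0 (mkC m r u 0) := by
  unfold Phi
  have : 0 ≤ ∑ β : Fin d → Fin r, mubl u β ⬝ᵥ Qbl m β *ᵥ mubl u β :=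
    Finset.sum_nonneg fun β _ => by rw [Qbl, dotProduct_Qmat_mulVec]; exact formM_nonneg _ _
  linarith

/-- `Φ(u) = M(u, s*)`. [folklore] -/
theorem Phi_eq (hm : 2 ≤ m) (u : {i : Amb (d := d) m r // Pbd m r i} → ℝ) :
    Phi u = formM pinI (0 : ZSite d) (fineN m r) 0 (mkC m r u (sStar hm u)) := by
  rw [formM_mkC_eq hm u (sStar hm u)]
  simp [tB_sStar]

/-- **Coercivity of the boundary form**: `Φ(u) ≥ c_n ‖u‖²`. [cite: arXiv160201222, Lemma 13.1] -/
theorem le_Phi (hm : 2 ≤ m) (u : {i : Amb (d := d) m r // Pbd m r i} → ℝ) :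
    cLow d (fineN m r) * ∑ j, u j ^ 2 ≤ Phi u := by
  rw [Phi_eq hm]
  set t := mkC m r u (sStar hm u) with ht
  have h1 := (form_bounds (pin := pinI) (a := (0 : ZSite d)) (n := fineN m r) (hpinI _) t).1
  rw [dotProduct_Qmat_mulVec, norm_toLp_sq] at h1
  have h2 : ∑ j, u j ^ 2 ≤ ∑ i, t i ^ 2 := by
    rw [← Fintype.sum_subtype_add_sum_subtype (Pbd m r) (fun i => t i ^ 2)]
    have e1 : ∑ j : {i : Amb (d := d) m r // Pbd m r i}, t j ^ 2 = ∑ j, u j ^ 2 :=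
      Finset.sum_congr rfl fun j _ => by rw [ht, mkC_apply_of_bd u _ j.2]
    rw [e1]
    have : 0 ≤ ∑ j : {i : Amb (d := d) m r // ¬ Pbd m r i}, t j ^ 2 := Finset.sum_nonneg fun _ _ => sq_nonneg _
    linarith
  exact le_trans (mul_le_mul_of_nonneg_left h2 cLow_pos.le) h1

/-- `M(u, 0) ≤ C_n ‖u‖²`. [folklore] -/
theorem formM_mkC_zero_le (u : {i : Amb (d := d) m r // Pbd m r i} → ℝ) :
    formM pinI (0 : ZSite d) (fineN m r) 0 (mkC m r u 0) ≤ cUp d (fineN m r) * ∑ j, u j ^ 2 := by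
  have h := formM_zero_le (pin := pinI) (a := (0 : ZSite d)) (n := fineN m r) (mkC m r u 0)
  have hsum : ∑ i, mkC m r u 0 i ^ 2 = ∑ j, u j ^ 2 := by
    rw [← Fintype.sum_subtype_add_sum_subtype (Pbd m r) (fun i => mkC m r u 0 i ^ 2)]
    have e1 : ∑ j : {i : Amb (d := d) m r // Pbd m r i}, mkC m r u 0 j ^ 2 = ∑ j, u j ^ 2 :=
      Finset.sum_congr rfl fun j _ => by rw [mkC_apply_of_bd u _ j.2]
    have e2 : ∑ j : {i : Amb (d := d) m r // ¬ Pbd m r i}, mkC m r u 0 j ^ 2 = 0 :=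
      Finset.sum_eq_zero fun j _ => by rw [mkC_apply_of_not_bd u _ j.2]; simp
    rw [e1, e2, add_zero]
  rw [hsum] at h
  refine h.trans ?_
  unfold cUp
  have : 0 ≤ ∑ j, u j ^ 2 := Finset.sum_nonneg fun _ _ => sq_nonneg _
  nlinarith

end Separable



/-! ### The factorisation `Z_M(B_n) = Y · Z₀^{r^d}` -/

section Factorisation

variable {m r : ℕ}

variable (m) in
/-- The Gaussian weight `e^{-½ M_0(x)}` of the reference block on `F₀ → ℝ`. [cite: arXiv160201222, §13] -/
def g0 (x : F₀ (d := d) m → ℝ) : ℝ≥0∞ :=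
  ENNReal.ofReal (Real.exp (-(formM (pinB m (B0 d)) (corner m (B0 d)) m 0 x) / 2))

/-- `g0` is measurable. [folklore] -/
theorem measurable_g0 : Measurable (g0 (d := d) m) := by
  unfold g0
  refine ENNReal.measurable_ofReal.comp (Real.measurable_exp.comp ?_)
  exact ((continuous_formM _).measurable.neg).div_const _

variable (m) in
/-- The Gaussian integral `Z₀` of the reference block. [cite: arXiv160201222, §15] -/
def Z0 : ℝ≥0∞ := gaussZ (Qmat (pinB m (B0 d)) (corner m (B0 d)) m)

/-- `∫ g0 = Z₀`. [folklore] -/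
theorem lintegral_g0 : ∫⁻ x : F₀ (d := d) m → ℝ, g0 m x = Z0 (d := d) m := by
  have hmp := PiLp.volume_preserving_toLp (F₀ (d := d) m)
  have hemb := (MeasurableEquiv.toLp 2 (F₀ (d := d) m → ℝ)).measurableEmbedding
  rw [Z0, gaussZ, ← hmp.lintegral_comp_emb hemb]
  refine lintegral_congr fun x => ?_
  rw [g0, gaussWeight_Qmat, WithLp.ofLp_toLp]

/-- `∫ g0(x - ν) dx = Z₀` (translation invariance). [folklore] -/
theorem lintegral_g0_sub (ν : F₀ (d := d) m → ℝ) : ∫⁻ x : F₀ (d := d) m → ℝ, g0 m (x - ν) = Z0 (d := d) m := by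
  rw [lintegral_sub_right_eq_self (g0 m) ν, lintegral_g0]

/-- `Z₀ ∈ (0, ∞)`. [folklore] -/
theorem Z0_ne_zero_and_ne_top : Z0 (d := d) m ≠ 0 ∧ Z0 (d := d) m ≠ ∞ := by
  obtain ⟨-, h0, htop⟩ := τ_eq_withDensity (pin := pinB m (B0 d)) (a := corner m (B0 d)) (n := m) (hpinB (B0 d))
  exact ⟨h0, htop⟩

/-- The curried transport of the interior coordinates to `blocks → (F₀ → ℝ)`. [folklore] -/
def Tm (hm : 2 ≤ m) : ({i : Amb (d := d) m r // ¬ Pbd m r i} → ℝ) ≃ᵐ ((Fin d → Fin r) → F₀ (d := d) m → ℝ) :=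
  (MeasurableEquiv.piCongrLeft (fun _ : (Fin d → Fin r) × F₀ (d := d) m => ℝ) (Ψ (r := r) hm)).trans
    (MeasurableEquiv.curry (Fin d → Fin r) (F₀ (d := d) m) ℝ)

/-- `Tm s β f = s (Ψ⁻¹ (β, f))`. [folklore] -/
theorem Tm_apply (hm : 2 ≤ m) (s : {i : Amb (d := d) m r // ¬ Pbd m r i} → ℝ) (β : Fin d → Fin r) (f : F₀ (d := d) m) :
    Tm hm s β f = s ((Ψ hm).symm (β, f)) := by
  rw [Tm, MeasurableEquiv.trans_apply, MeasurableEquiv.coe_curry, Function.curry_apply, MeasurableEquiv.coe_piCongrLeft]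
  conv_lhs => rw [← (Ψ (r := r) hm).apply_symm_apply (β, f)]
  rw [Equiv.piCongrLeft_apply_apply]

/-- `Tm` preserves Lebesgue measure. [folklore] -/
theorem measurePreserving_Tm (hm : 2 ≤ m) : MeasurePreserving (Tm (d := d) (m := m) (r := r) hm) volume volume := by
  have h1 := volume_measurePreserving_piCongrLeft (fun _ : (Fin d → Fin r) × F₀ (d := d) m => ℝ) (Ψ (r := r) hm)
  have h2 := volume_preserving_curry (Fin d → Fin r) (F₀ (d := d) m)
  exact h2.comp h1

/-- The block quadratic forms in the transported coordinates. [folklore] -/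
theorem block_form_eq (hm : 2 ≤ m) (u : {i : Amb (d := d) m r // Pbd m r i} → ℝ)
    (s : {i : Amb (d := d) m r // ¬ Pbd m r i} → ℝ) (β : Fin d → Fin r) :
    (tB hm (bz_valid β) (mkC m r u s) - mubl u β) ⬝ᵥ Qbl m β *ᵥ (tB hm (bz_valid β) (mkC m r u s) - mubl u β) =
      formM (pinB m (B0 d)) (corner m (B0 d)) m 0 (Tm hm s β - mubl u β ∘ σb hm (B0 d) (bz β)) := by
  rw [Qbl, dotProduct_Qmat_mulVec, ← formM_σb hm (B0 d) (bz β)]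
  congr 1
  funext e
  simp only [Function.comp_apply, Pi.sub_apply, Tm_apply, tB_mkC, Equiv.apply_symm_apply]

/-- **The pointwise factorisation of the ambient weight.** [cite: arXiv160201222, §15 (proof of Thm. 15.2)] -/
theorem Wamb_mkC_eq (hm : 2 ≤ m) (u : {i : Amb (d := d) m r // Pbd m r i} → ℝ)
    (s : {i : Amb (d := d) m r // ¬ Pbd m r i} → ℝ) :
    Wamb m r (mkC m r u s) =
      ENNReal.ofReal (Real.exp (-(Phi u) / 2)) * ∏ β : Fin d → Fin r, g0 m (Tm hm s β - mubl u β ∘ σb hm (B0 d) (bz β)) := by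
  rw [Wamb, formM_mkC_eq hm u s]
  simp only [block_form_eq hm u s]
  rw [neg_add, add_div, Real.exp_add, ENNReal.ofReal_mul (Real.exp_pos _).le]
  congr 1
  rw [← Finset.sum_neg_distrib, Finset.sum_div, Real.exp_sum,
    ENNReal.ofReal_prod_of_nonneg (fun _ _ => (Real.exp_pos _).le)]
  rfl

/-- **Integrating out the interiors**: `∫ W(u, s) ds = e^{-Φ(u)/2} Z₀^{r^d}`. [cite: arXiv160201222, §15 (proof of Thm. 15.2)] -/
theorem lintegral_Wamb_mkC (hm : 2 ≤ m) (u : {i : Amb (d := d) m r // Pbd m r i} → ℝ) :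
    ∫⁻ s, Wamb m r (mkC m r u s) = ENNReal.ofReal (Real.exp (-(Phi u) / 2)) * Z0 (d := d) m ^ (r ^ d) := by
  simp_rw [Wamb_mkC_eq hm u]
  have hG : Measurable fun x : (Fin d → Fin r) → F₀ (d := d) m → ℝ =>
      ∏ β : Fin d → Fin r, g0 m (x β - mubl u β ∘ σb hm (B0 d) (bz β)) := by
    refine Finset.measurable_prod _ fun β _ => ?_
    exact measurable_g0.comp ((measurable_pi_apply β).sub measurable_const)
  have hmeas : Measurable fun s : {i : Amb (d := d) m r // ¬ Pbd m r i} → ℝ =>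
      ∏ β : Fin d → Fin r, g0 m (Tm hm s β - mubl u β ∘ σb hm (B0 d) (bz β)) :=
    hG.comp (Tm hm).measurable
  rw [lintegral_const_mul _ hmeas]
  congr 1
  -- transport by `Tm`, then product over blocks, then translation invariance
  have h1 : ∫⁻ s : {i : Amb (d := d) m r // ¬ Pbd m r i} → ℝ,
      ∏ β : Fin d → Fin r, g0 m (Tm hm s β - mubl u β ∘ σb hm (B0 d) (bz β)) =
      ∫⁻ x : (Fin d → Fin r) → F₀ (d := d) m → ℝ, ∏ β : Fin d → Fin r, g0 m (x β - mubl u β ∘ σb hm (B0 d) (bz β)) :=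
    (measurePreserving_Tm hm).lintegral_comp_emb (Tm hm).measurableEmbedding
      (fun x : (Fin d → Fin r) → F₀ (d := d) m → ℝ => ∏ β : Fin d → Fin r, g0 m (x β - mubl u β ∘ σb hm (B0 d) (bz β)))
  rw [h1, volume_pi]
  rw [lintegral_fintype_prod_eq_prod (fun _ : Fin d → Fin r => (volume : Measure (F₀ (d := d) m → ℝ)))
    (f := fun β x => g0 m (x - mubl u β ∘ σb hm (B0 d) (bz β)))
    (fun β => measurable_g0.comp (measurable_id.sub measurable_const))]
  simp only [lintegral_g0_sub]
  rw [Finset.prod_const, Finset.card_univ, Fintype.card_fun, Fintype.card_fin, Fintype.card_fin]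

variable (m r) in
/-- The boundary integral `Y = ∫ e^{-Φ(u)/2} du`. [cite: arXiv160201222, §15] -/
def Yint : ℝ≥0∞ := ∫⁻ u : {i : Amb (d := d) m r // Pbd m r i} → ℝ, ENNReal.ofReal (Real.exp (-(Phi u) / 2))

/-- **The factorisation** `Z_M(B_n) = Y · Z₀^{r^d}` for `n = r(m-1)+1`. [cite: arXiv160201222, §15 (proof of Thm. 15.2: "`Z_{M,m}(B_n) = Z'_M(B_m)^{|𝒟|}`")] -/
theorem ZM_fine_eq (hm : 2 ≤ m) : ZM (d := d) (fineN m r) = Yint (d := d) m r * Z0 (d := d) m ^ (r ^ d) := by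
  have h := setLIntegral_Wamb_eq (d := d) (m := m) (r := r) Set.univ MeasurableSet.univ
  rw [Measure.restrict_univ, Set.preimage_univ, measure_univ, mul_one] at h
  rw [ZM, ← h, lintegral_split (Pbd m r) measurable_Wamb]
  have : ∀ u : {i : Amb (d := d) m r // Pbd m r i} → ℝ,
      ∫⁻ s, Wamb m r ((splitBI m r).symm (u, s)) = ENNReal.ofReal (Real.exp (-(Phi u) / 2)) * Z0 (d := d) m ^ (r ^ d) :=
    fun u => lintegral_Wamb_mkC hm u
  simp_rw [this]
  rw [lintegral_mul_const' _ _ (ENNReal.pow_ne_top (Z0_ne_zero_and_ne_top (d := d) (m := m)).2), Yint]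

end Factorisation


/-! ### Bounds for the boundary integral `Y` -/

section YBounds

variable {m r : ℕ}

/-- The one-dimensional Gaussian integral: `∫ e^{-cx²/2} dx = (2π/c)^{1/2}`. [folklore] -/
theorem lintegral_exp_neg_mul_sq_div_two {c : ℝ} (hc : 0 < c) :
    ∫⁻ x : ℝ, ENNReal.ofReal (Real.exp (-(c * x ^ 2) / 2)) = ENNReal.ofReal (Real.sqrt (2 * Real.pi / c)) := by
  have hint := integral_gaussian (c / 2)
  have heq : ∀ x : ℝ, Real.exp (-(c * x ^ 2) / 2) = Real.exp (-(c / 2) * x ^ 2) := fun x => by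
    congr 1; ring
  simp_rw [heq]
  rw [← ofReal_integral_eq_lintegral_ofReal (integrable_exp_neg_mul_sq (by positivity))
    (ae_of_all _ fun x => (Real.exp_pos _).le), hint]
  congr 1
  rw [div_div_eq_mul_div, mul_comm]

/-- The product Gaussian integral on `κ → ℝ`: `∫ e^{-c Σ x_j²/2} dx = (2π/c)^{|κ|/2}`. [folklore] -/
theorem lintegral_exp_neg_mul_sum_sq (κ : Type*) [Fintype κ] {c : ℝ} (hc : 0 < c) :
    ∫⁻ x : κ → ℝ, ENNReal.ofReal (Real.exp (-(c * ∑ j, x j ^ 2) / 2)) =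
      ENNReal.ofReal (Real.sqrt (2 * Real.pi / c) ^ Fintype.card κ) := by
  have heq : ∀ x : κ → ℝ, ENNReal.ofReal (Real.exp (-(c * ∑ j, x j ^ 2) / 2)) =
      ∏ j, ENNReal.ofReal (Real.exp (-(c * x j ^ 2) / 2)) := by
    intro x
    rw [Finset.mul_sum, ← Finset.sum_neg_distrib, Finset.sum_div, Real.exp_sum,
      ENNReal.ofReal_prod_of_nonneg (fun _ _ => (Real.exp_pos _).le)]
  simp_rw [heq]
  rw [volume_pi, lintegral_fintype_prod_eq_prod (fun _ : κ => (volume : Measure ℝ))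
    (f := fun _ x => ENNReal.ofReal (Real.exp (-(c * x ^ 2) / 2)))
    (fun _ => ENNReal.measurable_ofReal.comp (Real.measurable_exp.comp (by fun_prop)))]
  simp only [lintegral_exp_neg_mul_sq_div_two hc, Finset.prod_const, Finset.card_univ]
  rw [ENNReal.ofReal_pow (Real.sqrt_nonneg _)]

/-- **Upper bound for `Y`**: `Y ≤ (2π/c_n)^{|A|/2}`. [cite: arXiv160201222, §15] -/
theorem Yint_le (hm : 2 ≤ m) :
    Yint (d := d) m r ≤ ENNReal.ofReal (Real.sqrt (2 * Real.pi / cLow d (fineN m r)) ^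
      Fintype.card {i : Amb (d := d) m r // Pbd m r i}) := by
  rw [Yint, ← lintegral_exp_neg_mul_sum_sq _ cLow_pos]
  refine lintegral_mono fun u => ?_
  apply ENNReal.ofReal_le_ofReal
  apply Real.exp_le_exp.2
  have := le_Phi hm u
  linarith

/-- The cube of boundary configurations `{|u_j| ≤ η}` has volume `(2η)^{|A|}`. [folklore] -/
theorem volume_cube_bd {η : ℝ} (hη : 0 ≤ η) :
    volume {u : {i : Amb (d := d) m r // Pbd m r i} → ℝ | ∀ j, |u j| ≤ η} =
      ENNReal.ofReal ((2 * η) ^ Fintype.card {i : Amb (d := d) m r // Pbd m r i}) := by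
  have hset : {u : {i : Amb (d := d) m r // Pbd m r i} → ℝ | ∀ j, |u j| ≤ η} =
      Set.pi Set.univ fun _ => Set.Icc (-η) η := by
    ext u; simp only [Set.mem_setOf_eq, Set.mem_univ_pi, Set.mem_Icc, abs_le]
  rw [hset, volume_pi_pi]
  simp only [Real.volume_Icc, Finset.prod_const, Finset.card_univ]
  rw [← ENNReal.ofReal_pow (by linarith)]
  congr 2; ring

/-- **Lower bound for `Y`**: `Y ≥ (2 C_n^{-1/2} e^{-1/2})^{|A|}` (the cube `|u_j| ≤ C_n^{-1/2}`, where
`Φ(u) ≤ M(u,0) ≤ C_n‖u‖² ≤ |A|`). [cite: arXiv160201222, §15] -/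
theorem le_Yint :
    ENNReal.ofReal ((2 * (Real.sqrt (cUp d (fineN m r)))⁻¹ * Real.exp (-(1 / 2 : ℝ))) ^
      Fintype.card {i : Amb (d := d) m r // Pbd m r i}) ≤ Yint (d := d) m r := by
  set K := Fintype.card {i : Amb (d := d) m r // Pbd m r i} with hK
  set η : ℝ := (Real.sqrt (cUp d (fineN m r)))⁻¹ with hη
  have hC := cUp_pos (d := d) (n := fineN m r)
  have hη0 : 0 < η := by rw [hη]; positivity
  have hη2 : cUp d (fineN m r) * η ^ 2 = 1 := by
    rw [hη, inv_pow, Real.sq_sqrt hC.le, mul_inv_cancel₀ hC.ne']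
  set cube := {u : {i : Amb (d := d) m r // Pbd m r i} → ℝ | ∀ j, |u j| ≤ η} with hcube
  -- on the cube, `Φ ≤ |A|`
  have hPhi : ∀ u ∈ cube, Phi u ≤ K := by
    intro u hu
    have h1 := Phi_le (m := m) (r := r) u
    have h2 := formM_mkC_zero_le (m := m) (r := r) u
    have h3 : ∑ j, u j ^ 2 ≤ K * η ^ 2 := by
      calc ∑ j, u j ^ 2 ≤ ∑ _j : {i : Amb (d := d) m r // Pbd m r i}, η ^ 2 :=
            Finset.sum_le_sum fun j _ => by
              have := hu j
              rw [← sq_abs]; exact pow_le_pow_left₀ (abs_nonneg _) this 2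
        _ = K * η ^ 2 := by rw [Finset.sum_const, Finset.card_univ, nsmul_eq_mul]
    have h4 : cUp d (fineN m r) * ∑ j, u j ^ 2 ≤ K := by
      calc cUp d (fineN m r) * ∑ j, u j ^ 2 ≤ cUp d (fineN m r) * (K * η ^ 2) :=
            mul_le_mul_of_nonneg_left h3 hC.le
        _ = K := by rw [← mul_assoc, mul_comm _ (K : ℝ), mul_assoc, hη2, mul_one]
    linarith
  calc ENNReal.ofReal ((2 * η * Real.exp (-(1 / 2 : ℝ))) ^ K)
      = ENNReal.ofReal (Real.exp (-(K : ℝ) / 2)) * volume cube := by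
        rw [hcube, volume_cube_bd hη0.le, ← ENNReal.ofReal_mul (Real.exp_pos _).le, mul_pow, ← Real.exp_nat_mul]
        congr 1
        rw [mul_comm]
        congr 1
        congr 1; ring
    _ = ∫⁻ _u in cube, ENNReal.ofReal (Real.exp (-(K : ℝ) / 2)) := by rw [setLIntegral_const]
    _ ≤ ∫⁻ u in cube, ENNReal.ofReal (Real.exp (-(Phi u) / 2)) := by
        refine setLIntegral_mono' ?_ fun u hu => ?_
        · have : cube = ⋂ j, {u : {i : Amb (d := d) m r // Pbd m r i} → ℝ | |u j| ≤ η} := by ext; simp [hcube]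
          rw [this]; exact MeasurableSet.iInter fun j => measurableSet_le (by fun_prop) measurable_const
        · apply ENNReal.ofReal_le_ofReal
          apply Real.exp_le_exp.2
          have := hPhi u hu
          linarith
    _ ≤ Yint (d := d) m r := setLIntegral_le_lintegral _ _

end YBounds


/-! ### The key estimate `|log Z_M(B_n) - r^d log Z_M(B_m)| ≤ C n^d (log n + 1)/(m-1)` -/

section KeyEstimate

variable {m r : ℕ}

/-- `|A| = #Abdry`. [folklore] -/
theorem card_bd_eq : Fintype.card {i : Amb (d := d) m r // Pbd m r i} = (Abdry (d := d) m r).card := by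
  rw [Fintype.card_subtype]; rfl

variable (d) in
/-- The per-edge logarithmic cost `L(n) = ½ log(2π(d²n^{d+1}+1)) + ½ log(16d²n^d+1) + ½`. [folklore] -/
def Lc (n : ℕ) : ℝ :=
  Real.log (2 * Real.pi * ((d : ℝ) ^ 2 * (n : ℝ) ^ (d + 1) + 1)) / 2 + Real.log (16 * ((d : ℝ) ^ 2 * (n : ℝ) ^ d) + 1) / 2 + 1 / 2

/-- `log(2π/c_n) = log(2π(d²n^{d+1}+1))`. [folklore] -/
theorem log_two_pi_div_cLow (n : ℕ) :
    Real.log (2 * Real.pi / cLow d n) = Real.log (2 * Real.pi * ((d : ℝ) ^ 2 * (n : ℝ) ^ (d + 1) + 1)) := by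
  rw [cLow, div_inv_eq_mul]

/-- `0 ≤ log(2π/c_n)`. [folklore] -/
theorem log_two_pi_div_cLow_nonneg (n : ℕ) : 0 ≤ Real.log (2 * Real.pi / cLow d n) := by
  rw [log_two_pi_div_cLow]
  apply Real.log_nonneg
  have hπ : (3 : ℝ) < Real.pi := Real.pi_gt_three
  have : (0 : ℝ) ≤ (d : ℝ) ^ 2 * (n : ℝ) ^ (d + 1) := by positivity
  nlinarith

/-- `log C_n ≤ log(16d²n^d + 1)` and `0 ≤ log C_n`. [folklore] -/
theorem log_cUp_le (n : ℕ) : Real.log (cUp d n) ≤ Real.log (16 * ((d : ℝ) ^ 2 * (n : ℝ) ^ d) + 1) ∧ 0 ≤ Real.log (cUp d n) := by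
  have hP : (#(plaquettesIn (halfOpenBox d n)) : ℝ) ≤ d * d * (n : ℝ) ^ d := by
    exact_mod_cast card_plaquettesIn_le (d := d) n
  have hP0 : (0 : ℝ) ≤ #(plaquettesIn (halfOpenBox d n)) := by positivity
  have hC1 : (1 : ℝ) ≤ cUp d n := by unfold cUp; linarith
  refine ⟨Real.log_le_log (by linarith) ?_, Real.log_nonneg hC1⟩
  unfold cUp; nlinarith

/-- `L(n) ≥ 0`. [folklore] -/
theorem Lc_nonneg (n : ℕ) : 0 ≤ Lc d n := by
  unfold Lc
  have h1 := log_two_pi_div_cLow_nonneg (d := d) n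
  rw [log_two_pi_div_cLow] at h1
  have h2 : 0 ≤ Real.log (16 * ((d : ℝ) ^ 2 * (n : ℝ) ^ d) + 1) :=
    Real.log_nonneg (by have : (0:ℝ) ≤ (d : ℝ) ^ 2 * (n : ℝ) ^ d := by positivity
                        linarith)
  positivity

/-- `L` is monotone in `n`. [folklore] -/
theorem Lc_mono {n n' : ℕ} (h : n ≤ n') : Lc d n ≤ Lc d n' := by
  unfold Lc
  have hn : (n : ℝ) ≤ n' := by exact_mod_cast h
  have hn0 : (0 : ℝ) ≤ n := Nat.cast_nonneg n
  have hπ : 0 < 2 * Real.pi := by positivity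
  have e1 : Real.log (2 * Real.pi * ((d : ℝ) ^ 2 * (n : ℝ) ^ (d + 1) + 1)) ≤
      Real.log (2 * Real.pi * ((d : ℝ) ^ 2 * (n' : ℝ) ^ (d + 1) + 1)) := by
    apply Real.log_le_log (by positivity)
    gcongr
  have e2 : Real.log (16 * ((d : ℝ) ^ 2 * (n : ℝ) ^ d) + 1) ≤ Real.log (16 * ((d : ℝ) ^ 2 * (n' : ℝ) ^ d) + 1) := by
    apply Real.log_le_log (by positivity)
    gcongr
  linarith

/-- `Y ∈ (0, ∞)`. [folklore] -/
theorem Yint_ne_zero_and_ne_top (hm : 2 ≤ m) : Yint (d := d) m r ≠ 0 ∧ Yint (d := d) m r ≠ ∞ := by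
  constructor
  · intro h0
    have h := le_Yint (d := d) (m := m) (r := r)
    rw [h0, nonpos_iff_eq_zero, ENNReal.ofReal_eq_zero] at h
    have hC := cUp_pos (d := d) (n := fineN m r)
    have : (0 : ℝ) < (2 * (Real.sqrt (cUp d (fineN m r)))⁻¹ * Real.exp (-(1 / 2 : ℝ))) ^
        Fintype.card {i : Amb (d := d) m r // Pbd m r i} := by positivity
    linarith
  · exact ne_top_of_le_ne_top ENNReal.ofReal_ne_top (Yint_le hm)

/-- **Upper bound for `log Y`**: `log Y ≤ (|A|/2) log(2π/c_n)`. [cite: arXiv160201222, §15] -/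
theorem log_Yint_le (hm : 2 ≤ m) :
    Real.log (Yint (d := d) m r).toReal ≤ (Abdry (d := d) m r).card * (Real.log (2 * Real.pi / cLow d (fineN m r)) / 2) := by
  obtain ⟨hY0, hYtop⟩ := Yint_ne_zero_and_ne_top (d := d) (r := r) hm
  have hc := cLow_pos (d := d) (n := fineN m r)
  set sq := Real.sqrt (2 * Real.pi / cLow d (fineN m r)) with hsq
  have hsq0 : 0 < sq := by rw [hsq]; positivity
  have h1 : (Yint (d := d) m r).toReal ≤ sq ^ (Abdry (d := d) m r).card := by
    have := (ENNReal.toReal_le_toReal hYtop ENNReal.ofReal_ne_top).2 (Yint_le (d := d) (r := r) hm)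
    rwa [ENNReal.toReal_ofReal (by positivity), card_bd_eq] at this
  calc Real.log (Yint (d := d) m r).toReal ≤ Real.log (sq ^ (Abdry (d := d) m r).card) :=
        Real.log_le_log (ENNReal.toReal_pos hY0 hYtop) h1
    _ = (Abdry (d := d) m r).card * (Real.log (2 * Real.pi / cLow d (fineN m r)) / 2) := by
        rw [Real.log_pow, hsq, Real.log_sqrt (by positivity)]

/-- **Lower bound for `log Y`**: `log Y ≥ -|A|(½ log C_n + ½)`. [cite: arXiv160201222, §15] -/
theorem le_log_Yint (hm : 2 ≤ m) :
    -((Abdry (d := d) m r).card * (Real.log (cUp d (fineN m r)) / 2 + 1 / 2)) ≤ Real.log (Yint (d := d) m r).toReal := by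
  obtain ⟨hY0, hYtop⟩ := Yint_ne_zero_and_ne_top (d := d) (r := r) hm
  have hC := cUp_pos (d := d) (n := fineN m r)
  set b := 2 * (Real.sqrt (cUp d (fineN m r)))⁻¹ * Real.exp (-(1 / 2 : ℝ)) with hb
  have hb0 : 0 < b := by rw [hb]; positivity
  have h1 : b ^ (Abdry (d := d) m r).card ≤ (Yint (d := d) m r).toReal := by
    have := (ENNReal.toReal_le_toReal ENNReal.ofReal_ne_top hYtop).2 (le_Yint (d := d) (m := m) (r := r))
    rwa [ENNReal.toReal_ofReal (by positivity), card_bd_eq] at this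
  have hlogb : Real.log b = Real.log 2 - Real.log (cUp d (fineN m r)) / 2 - 1 / 2 := by
    rw [hb, Real.log_mul (by positivity) (Real.exp_pos _).ne', Real.log_mul two_ne_zero (by positivity),
      Real.log_inv, Real.log_sqrt hC.le, Real.log_exp]
    ring
  have hlog2 : 0 ≤ Real.log 2 := Real.log_nonneg one_le_two
  calc -((Abdry (d := d) m r).card * (Real.log (cUp d (fineN m r)) / 2 + 1 / 2))
      ≤ (Abdry (d := d) m r).card * Real.log b := by
        rw [hlogb]; have : (0 : ℝ) ≤ (Abdry (d := d) m r).card := Nat.cast_nonneg _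
        nlinarith
    _ = Real.log (b ^ (Abdry (d := d) m r).card) := by rw [Real.log_pow]
    _ ≤ Real.log (Yint (d := d) m r).toReal := Real.log_le_log (by positivity) h1

/-- **`|log Y| ≤ |A| L(n)`.** [cite: arXiv160201222, §15] -/
theorem abs_log_Yint_le (hm : 2 ≤ m) :
    |Real.log (Yint (d := d) m r).toReal| ≤ (Abdry (d := d) m r).card * Lc d (fineN m r) := by
  have h1 := log_Yint_le (d := d) (r := r) hm
  have h2 := le_log_Yint (d := d) (r := r) hm
  obtain ⟨hcu, hcu0⟩ := log_cUp_le (d := d) (fineN m r)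
  have hcl := log_two_pi_div_cLow_nonneg (d := d) (fineN m r)
  rw [log_two_pi_div_cLow] at h1 hcl
  have hA : (0 : ℝ) ≤ (Abdry (d := d) m r).card := Nat.cast_nonneg _
  have hlog2 : 0 ≤ Real.log (16 * ((d : ℝ) ^ 2 * ((fineN m r : ℕ) : ℝ) ^ d) + 1) := le_trans hcu0 hcu
  rw [abs_le]
  unfold Lc
  constructor
  · nlinarith [mul_le_mul_of_nonneg_left hcu hA]
  · nlinarith

/-- **The logarithm of the factorisation**: `log Z_M(B_n) = log Y + r^d log Z₀`. [cite: arXiv160201222, §15] -/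
theorem logZM_fine_eq (hm : 2 ≤ m) :
    logZM d (fineN m r) = Real.log (Yint (d := d) m r).toReal + r ^ d * Real.log (Z0 (d := d) m).toReal := by
  obtain ⟨hY0, hYtop⟩ := Yint_ne_zero_and_ne_top (d := d) (r := r) hm
  obtain ⟨hZ0, hZtop⟩ := Z0_ne_zero_and_ne_top (d := d) (m := m)
  rw [logZM, ZM_fine_eq hm, ENNReal.toReal_mul, ENNReal.toReal_pow,
    Real.log_mul (ENNReal.toReal_pos hY0 hYtop).ne' (pow_ne_zero _ (ENNReal.toReal_pos hZ0 hZtop).ne'), Real.log_pow]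
  push_cast; ring

/-- `fineN m 1 = m` for `m ≥ 1`. [folklore] -/
theorem fineN_one (hm : 1 ≤ m) : fineN m 1 = m := by
  unfold fineN; omega

/-- **The key estimate**: for `m ≥ 2`, `r ≥ 1`, `n = r(m-1)+1`,
`|log Z_M(B_n) - r^d log Z_M(B_m)| ≤ 4d²(1 + 2^d) n^d L(n)/(m-1)`. [cite: arXiv160201222, Thm. 15.2 (proof), Lemmas 15.3–15.4] -/
theorem abs_logZM_sub_le (hm : 2 ≤ m) (hr : 1 ≤ r) :
    |logZM d (fineN m r) - (r : ℝ) ^ d * logZM d m| ≤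
      4 * (d : ℝ) ^ 2 * (1 + 2 ^ d) * (fineN m r : ℝ) ^ d * Lc d (fineN m r) / ((m : ℝ) - 1) := by
  set n := fineN m r with hn
  have hm1 : 1 ≤ m := by omega
  have h1 := logZM_fine_eq (d := d) (r := r) hm
  have h2 := logZM_fine_eq (d := d) (r := 1) hm
  rw [fineN_one hm1, Nat.cast_one, one_pow, one_mul] at h2
  have hdiff : logZM d n - (r : ℝ) ^ d * logZM d m =
      Real.log (Yint (d := d) m r).toReal - (r : ℝ) ^ d * Real.log (Yint (d := d) m 1).toReal := by
    rw [hn, h1, h2]; ring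
  rw [hdiff]
  have hYr := abs_log_Yint_le (d := d) (r := r) hm
  have hY1 := abs_log_Yint_le (d := d) (r := 1) hm
  rw [fineN_one hm1] at hY1
  have hAr := card_Abdry_le_real (d := d) (r := r) hm hr
  have hA1 := card_Abdry_le_real (d := d) (r := 1) hm le_rfl
  rw [fineN_one hm1] at hA1
  have hM : (0 : ℝ) < (m : ℝ) - 1 := by
    have : (2 : ℝ) ≤ m := by exact_mod_cast hm
    linarith
  have hmn : m ≤ n := by
    rw [hn, fineN]
    have : m - 1 ≤ r * (m - 1) := Nat.le_mul_of_pos_left _ hr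
    omega
  have hLm : Lc d m ≤ Lc d n := Lc_mono hmn
  have hL0 : 0 ≤ Lc d m := Lc_nonneg m
  have hLn0 : 0 ≤ Lc d n := Lc_nonneg n
  -- `r^d m^d ≤ 2^d n^d`
  have hrm : (r : ℝ) * m ≤ 2 * n := by
    have : (n : ℝ) = r * ((m : ℝ) - 1) + 1 := by
      rw [hn, fineN]; push_cast; rw [Nat.cast_sub hm1]; push_cast; ring
    have hr1 : (1 : ℝ) ≤ r := by exact_mod_cast hr
    have hm2 : (2 : ℝ) ≤ m := by exact_mod_cast hm
    nlinarith
  have hrmd : (r : ℝ) ^ d * (m : ℝ) ^ d ≤ 2 ^ d * (n : ℝ) ^ d := by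
    rw [← mul_pow, ← mul_pow]; exact pow_le_pow_left₀ (by positivity) hrm d
  -- assemble
  have hA0 : (0 : ℝ) ≤ (Abdry (d := d) m r).card := Nat.cast_nonneg _
  have hA10 : (0 : ℝ) ≤ (Abdry (d := d) m 1).card := Nat.cast_nonneg _
  have t1 : |Real.log (Yint (d := d) m r).toReal| ≤ 4 * (d : ℝ) ^ 2 * (n : ℝ) ^ d / ((m : ℝ) - 1) * Lc d n :=
    hYr.trans (mul_le_mul_of_nonneg_right hAr hLn0)
  have t2 : |(r : ℝ) ^ d * Real.log (Yint (d := d) m 1).toReal| ≤ 2 ^ d * (4 * (d : ℝ) ^ 2 * (n : ℝ) ^ d / ((m : ℝ) - 1)) * Lc d n := by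
    rw [abs_mul, abs_of_nonneg (by positivity)]
    calc (r : ℝ) ^ d * |Real.log (Yint (d := d) m 1).toReal| ≤ (r : ℝ) ^ d * ((Abdry (d := d) m 1).card * Lc d m) :=
          mul_le_mul_of_nonneg_left hY1 (by positivity)
      _ ≤ (r : ℝ) ^ d * ((4 * (d : ℝ) ^ 2 * (m : ℝ) ^ d / ((m : ℝ) - 1)) * Lc d n) := by
          apply mul_le_mul_of_nonneg_left _ (by positivity)
          exact mul_le_mul hA1 hLm hL0 (by positivity)
      _ = ((r : ℝ) ^ d * (m : ℝ) ^ d) * (4 * (d : ℝ) ^ 2 / ((m : ℝ) - 1)) * Lc d n := by ring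
      _ ≤ (2 ^ d * (n : ℝ) ^ d) * (4 * (d : ℝ) ^ 2 / ((m : ℝ) - 1)) * Lc d n := by gcongr
      _ = 2 ^ d * (4 * (d : ℝ) ^ 2 * (n : ℝ) ^ d / ((m : ℝ) - 1)) * Lc d n := by ring
  calc |Real.log (Yint (d := d) m r).toReal - (r : ℝ) ^ d * Real.log (Yint (d := d) m 1).toReal|
      ≤ |Real.log (Yint (d := d) m r).toReal| + |(r : ℝ) ^ d * Real.log (Yint (d := d) m 1).toReal| := abs_sub _ _
    _ ≤ 4 * (d : ℝ) ^ 2 * (n : ℝ) ^ d / ((m : ℝ) - 1) * Lc d n + 2 ^ d * (4 * (d : ℝ) ^ 2 * (n : ℝ) ^ d / ((m : ℝ) - 1)) * Lc d n :=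
        add_le_add t1 t2
    _ = 4 * (d : ℝ) ^ 2 * (1 + 2 ^ d) * (n : ℝ) ^ d * Lc d n / ((m : ℝ) - 1) := by
        field_simp

end KeyEstimate


/-! ### Theorem 15.2: convergence of the free energy per site `log Z_M(B_n)/n^d` -/

section Limit

/-- **Lemma 15.1 (a priori bound)**: `|log Z_M(B_n)| ≤ d n^d L(n)`. [cite: arXiv160201222, Lemma 15.1] -/
theorem abs_logZM_le (n : ℕ) : |logZM d n| ≤ d * (n : ℝ) ^ d * Lc d n := by
  set Q := Qmat pinI (0 : ZSite d) n with hQ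
  set D := Fintype.card (Free (pinI (d := d)) (0 : ZSite d) n) with hD
  have hc := cLow_pos (d := d) (n := n)
  have hC := cUp_pos (d := d) (n := n)
  have hup := gaussZ_le hc (fun v => (form_bounds (pin := pinI) (a := (0 : ZSite d)) (n := n) (hpinI n) v).1)
  have hlow := le_gaussZ hC (fun v => (form_bounds (pin := pinI) (a := (0 : ZSite d)) (n := n) (hpinI n) v).2)
  obtain ⟨hZ0, hZtop⟩ := ZM_ne_zero_and_ne_top (d := d) (n := n)
  have hZpos := ZM_toReal_pos (d := d) (n := n)
  have hDle : (D : ℝ) ≤ d * (n : ℝ) ^ d := by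
    have h1 : D = D₁ d n := (Fintype.card_congr (idx (d := d) (n := n))).symm
    rw [h1, D₁, card_freeIdx]
    exact_mod_cast card_freeEdges_le (d := d) n
  have hD0 : (0 : ℝ) ≤ D := Nat.cast_nonneg D
  -- upper
  have h1 : logZM d n ≤ D * (Real.log (2 * Real.pi / cLow d n) / 2) := by
    have := (ENNReal.toReal_le_toReal hZtop ENNReal.ofReal_ne_top).2 hup
    rw [ENNReal.toReal_ofReal (by positivity)] at this
    calc logZM d n ≤ Real.log ((Real.sqrt (2 * Real.pi) / Real.sqrt (cLow d n)) ^ D) := Real.log_le_log hZpos this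
      _ = D * (Real.log (2 * Real.pi / cLow d n) / 2) := by
          rw [Real.log_pow, ← Real.sqrt_div' _ hc.le, Real.log_sqrt (by positivity)]
  -- lower
  have h2 : D * ((Real.log (2 * Real.pi) - Real.log (cUp d n)) / 2) ≤ logZM d n := by
    have := (ENNReal.toReal_le_toReal ENNReal.ofReal_ne_top hZtop).2 hlow
    rw [ENNReal.toReal_ofReal (by positivity)] at this
    calc (D : ℝ) * ((Real.log (2 * Real.pi) - Real.log (cUp d n)) / 2)
        = Real.log ((Real.sqrt (2 * Real.pi) / Real.sqrt (cUp d n)) ^ D) := by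
          rw [Real.log_pow, Real.log_div (Real.sqrt_pos.2 (by positivity)).ne' (Real.sqrt_pos.2 hC).ne',
            Real.log_sqrt (by positivity), Real.log_sqrt hC.le]; ring
      _ ≤ logZM d n := Real.log_le_log (by positivity) this
  have hl2π : 0 ≤ Real.log (2 * Real.pi) := Real.log_nonneg (by linarith [Real.pi_gt_three])
  obtain ⟨hcu, hcu0⟩ := log_cUp_le (d := d) n
  have hcl := log_two_pi_div_cLow_nonneg (d := d) n
  rw [log_two_pi_div_cLow] at h1 hcl
  have hLc : Lc d n = Real.log (2 * Real.pi * ((d : ℝ) ^ 2 * (n : ℝ) ^ (d + 1) + 1)) / 2 +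
      Real.log (16 * ((d : ℝ) ^ 2 * (n : ℝ) ^ d) + 1) / 2 + 1 / 2 := rfl
  rw [abs_le]
  constructor
  · -- `-(d n^d L) ≤ logZM`
    have : -(D * (Real.log (cUp d n) / 2)) ≤ logZM d n := by nlinarith
    have h3 : D * (Real.log (cUp d n) / 2) ≤ d * (n : ℝ) ^ d * Lc d n := by
      calc (D : ℝ) * (Real.log (cUp d n) / 2) ≤ D * Lc d n := by
            apply mul_le_mul_of_nonneg_left _ hD0
            rw [hLc]; nlinarith
        _ ≤ d * (n : ℝ) ^ d * Lc d n := mul_le_mul_of_nonneg_right hDle (Lc_nonneg n)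
    linarith
  · calc logZM d n ≤ D * (Real.log (2 * Real.pi * ((d : ℝ) ^ 2 * (n : ℝ) ^ (d + 1) + 1)) / 2) := h1
      _ ≤ D * Lc d n := by
          apply mul_le_mul_of_nonneg_left _ hD0
          rw [hLc]; nlinarith [le_trans hcu0 hcu]
      _ ≤ d * (n : ℝ) ^ d * Lc d n := mul_le_mul_of_nonneg_right hDle (Lc_nonneg n)

variable (d) in
/-- The free energy per site `f(n) = log Z_M(B_n)/n^d` (`F_M(B_n)` up to the `(2π)`-shift). [cite: arXiv160201222, §15] -/
def fM (n : ℕ) : ℝ := logZM d n / (n : ℝ) ^ d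

variable (d) in
/-- The constant `C = 4d²(1+2^d) + d²2^{d-1}` of the consistency estimate. [folklore] -/
def Cke : ℝ := 4 * (d : ℝ) ^ 2 * (1 + 2 ^ d) + (d : ℝ) ^ 2 * 2 ^ (d - 1)

/-- `|f(m)| ≤ d L(m)`. [cite: arXiv160201222, Lemma 15.1] -/
theorem abs_fM_le {n : ℕ} (hn : 1 ≤ n) : |fM d n| ≤ d * Lc d n := by
  have h := abs_logZM_le (d := d) n
  have hn0 : (0 : ℝ) < (n : ℝ) ^ d := by positivity
  rw [fM, abs_div, abs_of_pos hn0, div_le_iff₀ hn0]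
  calc |logZM d n| ≤ d * (n : ℝ) ^ d * Lc d n := h
    _ = d * Lc d n * (n : ℝ) ^ d := by ring

/-- **Consistency of the free energy across a divisibility chain** (Lemmas 15.3/15.4 ⇒
`|F_M(B_n) - F_M(B_m)| ≤ C L(n)/(m-1)` for `n = r(m-1)+1`). [cite: arXiv160201222, Thm. 15.2 (proof, eq. `fmbn3`)] -/
theorem abs_fM_sub_le {m r : ℕ} (hm : 2 ≤ m) (hr : 1 ≤ r) :
    |fM d (fineN m r) - fM d m| ≤ Cke d * Lc d (fineN m r) / ((m : ℝ) - 1) := by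
  set n := fineN m r with hn
  have hm1 : 1 ≤ m := by omega
  have hkey := abs_logZM_sub_le (d := d) hm hr
  have hM : (0 : ℝ) < (m : ℝ) - 1 := by
    have : (2 : ℝ) ≤ m := by exact_mod_cast hm
    linarith
  have hnr : (n : ℝ) = r * ((m : ℝ) - 1) + 1 := by
    rw [hn, fineN]; push_cast; rw [Nat.cast_sub hm1]; push_cast; ring
  have hr1 : (1 : ℝ) ≤ r := by exact_mod_cast hr
  have hm0 : (0 : ℝ) < m := by positivity
  have hn0 : (0 : ℝ) < n := by rw [hnr]; positivity
  have hnd : (0 : ℝ) < (n : ℝ) ^ d := by positivity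
  have hmd : (0 : ℝ) < (m : ℝ) ^ d := by positivity
  have hmn : m ≤ n := by
    rw [hn, fineN]
    have : m - 1 ≤ r * (m - 1) := Nat.le_mul_of_pos_left _ hr
    omega
  -- `ρ = rm/n ∈ [1, 1 + 1/(m-1)]`
  set ρ : ℝ := (r : ℝ) * m / n with hρ
  have hρ1 : 1 ≤ ρ := by rw [hρ, le_div_iff₀ hn0, one_mul, hnr]; nlinarith
  have hρ2 : ρ - 1 ≤ 1 / ((m : ℝ) - 1) := by
    rw [hρ, div_sub_one hn0.ne', div_le_div_iff₀ hn0 hM, one_mul, hnr]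
    nlinarith
  have hm2 : (2 : ℝ) ≤ m := by exact_mod_cast hm
  have hρ3 : ρ - 1 ≤ 1 := hρ2.trans (by rw [div_le_one hM]; linarith)
  -- Bernoulli: `(1 + x)^d - 1 ≤ d 2^{d-1} x` on `[0, 1]`
  have hbern : ∀ x : ℝ, 0 ≤ x → x ≤ 1 → (1 + x) ^ d - 1 ≤ d * 2 ^ (d - 1) * x := by
    intro x hx0 hx1
    have hgeom : (1 + x) ^ d - 1 = x * ∑ i ∈ Finset.range d, (1 + x) ^ i := by
      have := geom_sum_mul (1 + x) d
      rw [add_sub_cancel_left] at this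
      linarith [this]
    rw [hgeom]
    have hsum : ∑ i ∈ Finset.range d, (1 + x) ^ i ≤ d * 2 ^ (d - 1) := by
      calc ∑ i ∈ Finset.range d, (1 + x) ^ i ≤ ∑ _i ∈ Finset.range d, (2 : ℝ) ^ (d - 1) := by
            refine Finset.sum_le_sum fun i hi => ?_
            rw [Finset.mem_range] at hi
            calc (1 + x) ^ i ≤ (2 : ℝ) ^ i := pow_le_pow_left₀ (by linarith) (by linarith) i
              _ ≤ 2 ^ (d - 1) := pow_le_pow_right₀ one_le_two (by omega)
        _ = d * 2 ^ (d - 1) := by rw [Finset.sum_const, Finset.card_range, nsmul_eq_mul]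
    nlinarith
  have hpow : ρ ^ d - 1 ≤ d * 2 ^ (d - 1) * (1 / ((m : ℝ) - 1)) := by
    have h := hbern (ρ - 1) (by linarith) hρ3
    rw [add_sub_cancel] at h
    exact h.trans (by gcongr)
  have hpow0 : 0 ≤ ρ ^ d - 1 := by have := one_le_pow₀ (M₀ := ℝ) hρ1 (n := d); linarith
  -- decomposition `f n - f m = A/n^d + (ρ^d - 1) f m`
  have hdec : fM d n - fM d m = (logZM d n - (r : ℝ) ^ d * logZM d m) / (n : ℝ) ^ d + (ρ ^ d - 1) * fM d m := by
    simp only [fM, hρ, div_pow, mul_pow]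
    field_simp
    ring
  rw [hdec]
  have hfm := abs_fM_le (d := d) hm1
  have hLm : Lc d m ≤ Lc d n := Lc_mono hmn
  have hL0 := Lc_nonneg (d := d) n
  have t1 : |(logZM d n - (r : ℝ) ^ d * logZM d m) / (n : ℝ) ^ d| ≤ 4 * (d : ℝ) ^ 2 * (1 + 2 ^ d) * Lc d n / ((m : ℝ) - 1) := by
    rw [abs_div, abs_of_pos hnd, div_le_iff₀ hnd]
    calc |logZM d n - (r : ℝ) ^ d * logZM d m| ≤ 4 * (d : ℝ) ^ 2 * (1 + 2 ^ d) * (n : ℝ) ^ d * Lc d n / ((m : ℝ) - 1) := hkey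
      _ = 4 * (d : ℝ) ^ 2 * (1 + 2 ^ d) * Lc d n / ((m : ℝ) - 1) * (n : ℝ) ^ d := by field_simp
  have t2 : |(ρ ^ d - 1) * fM d m| ≤ (d : ℝ) ^ 2 * 2 ^ (d - 1) * Lc d n / ((m : ℝ) - 1) := by
    rw [abs_mul, abs_of_nonneg hpow0]
    calc (ρ ^ d - 1) * |fM d m| ≤ (d * 2 ^ (d - 1) * (1 / ((m : ℝ) - 1))) * (d * Lc d n) :=
          mul_le_mul hpow (hfm.trans (by gcongr)) (abs_nonneg _) (by positivity)
      _ = (d : ℝ) ^ 2 * 2 ^ (d - 1) * Lc d n / ((m : ℝ) - 1) := by field_simp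
  calc |(logZM d n - (r : ℝ) ^ d * logZM d m) / (n : ℝ) ^ d + (ρ ^ d - 1) * fM d m|
      ≤ |(logZM d n - (r : ℝ) ^ d * logZM d m) / (n : ℝ) ^ d| + |(ρ ^ d - 1) * fM d m| := abs_add_le _ _
    _ ≤ 4 * (d : ℝ) ^ 2 * (1 + 2 ^ d) * Lc d n / ((m : ℝ) - 1) + (d : ℝ) ^ 2 * 2 ^ (d - 1) * Lc d n / ((m : ℝ) - 1) :=
        add_le_add t1 t2
    _ = Cke d * Lc d n / ((m : ℝ) - 1) := by unfold Cke; ring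

/-- `L(n) ≤ (d+1) log n + 2 log d + 4` for `d, n ≥ 1`. [folklore] -/
theorem Lc_le (hd : 1 ≤ d) {n : ℕ} (hn : 1 ≤ n) : Lc d n ≤ ((d : ℝ) + 1) * Real.log n + (2 * Real.log d + 4) := by
  unfold Lc
  have hn0 : (0 : ℝ) < n := by exact_mod_cast hn
  have hn1 : (1 : ℝ) ≤ n := by exact_mod_cast hn
  have hd1 : (1 : ℝ) ≤ d := by exact_mod_cast hd
  have hd0 : (0 : ℝ) < d := by positivity
  have hlogn : 0 ≤ Real.log n := Real.log_nonneg hn1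
  have hlogd : 0 ≤ Real.log d := Real.log_nonneg hd1
  have hπ3 := Real.pi_lt_d2
  have hlog2 : Real.log 2 ≤ 1 := by have := Real.log_two_lt_d9; linarith
  have hl2π : Real.log (2 * Real.pi) ≤ 2 := by
    have he : (2.7182818283 : ℝ) < Real.exp 1 := Real.exp_one_gt_d9
    have he2 : Real.exp 2 = Real.exp 1 * Real.exp 1 := by rw [← Real.exp_add]; norm_num
    calc Real.log (2 * Real.pi) ≤ Real.log (Real.exp 2) := Real.log_le_log (by positivity) (by rw [he2]; nlinarith)
      _ = 2 := Real.log_exp 2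
  have h17 : Real.log 17 ≤ 3 := by
    have he : (2.7182818283 : ℝ) < Real.exp 1 := Real.exp_one_gt_d9
    have he3 : Real.exp 3 = Real.exp 1 * Real.exp 1 * Real.exp 1 := by rw [← Real.exp_add, ← Real.exp_add]; norm_num
    calc Real.log 17 ≤ Real.log (Real.exp 3) := Real.log_le_log (by norm_num) (by rw [he3]; nlinarith)
      _ = 3 := Real.log_exp 3
  -- first logarithm
  have hA : (1 : ℝ) ≤ (d : ℝ) ^ 2 * (n : ℝ) ^ (d + 1) := by
    have : (1 : ℝ) ≤ (d : ℝ) ^ 2 := by nlinarith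
    have : (1 : ℝ) ≤ (n : ℝ) ^ (d + 1) := one_le_pow₀ hn1
    nlinarith
  have e1 : Real.log (2 * Real.pi * ((d : ℝ) ^ 2 * (n : ℝ) ^ (d + 1) + 1)) ≤ 2 + 1 + 2 * Real.log d + ((d : ℝ) + 1) * Real.log n := by
    have hle : 2 * Real.pi * ((d : ℝ) ^ 2 * (n : ℝ) ^ (d + 1) + 1) ≤ (2 * Real.pi) * (2 * ((d : ℝ) ^ 2 * (n : ℝ) ^ (d + 1))) := by
      nlinarith [Real.pi_pos]
    calc Real.log (2 * Real.pi * ((d : ℝ) ^ 2 * (n : ℝ) ^ (d + 1) + 1))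
        ≤ Real.log ((2 * Real.pi) * (2 * ((d : ℝ) ^ 2 * (n : ℝ) ^ (d + 1)))) := Real.log_le_log (by positivity) hle
      _ = Real.log (2 * Real.pi) + (Real.log 2 + (2 * Real.log d + ((d : ℝ) + 1) * Real.log n)) := by
          have hx : Real.log ((2 * Real.pi) * (2 * ((d : ℝ) ^ 2 * (n : ℝ) ^ (d + 1)))) =
              Real.log (2 * Real.pi) + Real.log (2 * ((d : ℝ) ^ 2 * (n : ℝ) ^ (d + 1))) :=
            Real.log_mul (by positivity) (by positivity)
          have hy : Real.log (2 * ((d : ℝ) ^ 2 * (n : ℝ) ^ (d + 1))) =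
              Real.log 2 + (Real.log ((d : ℝ) ^ 2) + Real.log ((n : ℝ) ^ (d + 1))) := by
            rw [Real.log_mul (by norm_num) (by positivity), Real.log_mul (by positivity) (by positivity)]
          rw [hx, hy, Real.log_pow, Real.log_pow]; push_cast; ring
      _ ≤ 2 + 1 + 2 * Real.log d + ((d : ℝ) + 1) * Real.log n := by linarith
  -- second logarithm
  have hB : (1 : ℝ) ≤ (d : ℝ) ^ 2 * (n : ℝ) ^ d := by
    have : (1 : ℝ) ≤ (d : ℝ) ^ 2 := by nlinarith
    have : (1 : ℝ) ≤ (n : ℝ) ^ d := one_le_pow₀ hn1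
    nlinarith
  have e2 : Real.log (16 * ((d : ℝ) ^ 2 * (n : ℝ) ^ d) + 1) ≤ 3 + 2 * Real.log d + d * Real.log n := by
    have hle : 16 * ((d : ℝ) ^ 2 * (n : ℝ) ^ d) + 1 ≤ 17 * ((d : ℝ) ^ 2 * (n : ℝ) ^ d) := by linarith
    calc Real.log (16 * ((d : ℝ) ^ 2 * (n : ℝ) ^ d) + 1) ≤ Real.log (17 * ((d : ℝ) ^ 2 * (n : ℝ) ^ d)) :=
          Real.log_le_log (by positivity) hle
      _ = Real.log 17 + (2 * Real.log d + d * Real.log n) := by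
          rw [Real.log_mul (by norm_num) (by positivity), Real.log_mul (by positivity) (by positivity),
            Real.log_pow, Real.log_pow]; push_cast; ring
      _ ≤ 3 + 2 * Real.log d + d * Real.log n := by linarith
  have hdl : 0 ≤ (d : ℝ) * Real.log n := by positivity
  linarith

/-- The dyadic side lengths `2^k + 1` and their divisibility chain. [cite: arXiv160201222, Thm. 15.2 (proof)] -/
theorem fineN_dyadic (k : ℕ) : fineN (2 ^ k + 1) 2 = 2 ^ (k + 1) + 1 := by
  unfold fineN; rw [pow_succ, Nat.add_sub_cancel]; ring

/-- **The dyadic subsequence is Cauchy**: `|f(2^{k+1}+1) - f(2^k+1)| ≤ C((d+1)(k+2) + 2d + 4)/2^k`. [cite: arXiv160201222, Thm. 15.2 (proof)] -/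
theorem abs_fM_dyadic_le (hd : 1 ≤ d) (k : ℕ) :
    |fM d (2 ^ (k + 1) + 1) - fM d (2 ^ k + 1)| ≤ Cke d * (((d : ℝ) + 1) * (k + 2) + (2 * d + 4)) / 2 ^ k := by
  have h := abs_fM_sub_le (d := d) (m := 2 ^ k + 1) (r := 2) (by have := Nat.one_le_two_pow (n := k); omega) (by norm_num)
  have hk1 : 1 ≤ 2 ^ (k + 1) := Nat.one_le_two_pow
  rw [fineN_dyadic] at h
  have hm : ((2 ^ k + 1 : ℕ) : ℝ) - 1 = 2 ^ k := by push_cast; ring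
  rw [hm] at h
  refine h.trans ?_
  have hC : 0 ≤ Cke d := by unfold Cke; positivity
  apply div_le_div_of_nonneg_right _ (by positivity)
  apply mul_le_mul_of_nonneg_left _ hC
  have hn1 : 1 ≤ 2 ^ (k + 1) + 1 := by omega
  refine (Lc_le hd hn1).trans ?_
  have hlog : Real.log ((2 ^ (k + 1) + 1 : ℕ) : ℝ) ≤ k + 2 := by
    have h2 : ((2 ^ (k + 1) + 1 : ℕ) : ℝ) ≤ 2 ^ (k + 2) := by
      have : 2 ^ (k + 1) + 1 ≤ 2 ^ (k + 2) := by rw [pow_succ 2 (k+1)]; have := Nat.one_le_two_pow (n := k + 1); omega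
      exact_mod_cast this
    calc Real.log ((2 ^ (k + 1) + 1 : ℕ) : ℝ) ≤ Real.log (2 ^ (k + 2)) := Real.log_le_log (by positivity) h2
      _ = (k + 2) * Real.log 2 := by rw [Real.log_pow]; push_cast; ring
      _ ≤ (k + 2) * 1 := by gcongr; have := Real.log_two_lt_d9; linarith
      _ = k + 2 := mul_one _
  have hlogd : Real.log d ≤ d := (Real.log_le_sub_one_of_pos (by exact_mod_cast Nat.lt_of_lt_of_le Nat.zero_lt_one hd)).trans (by linarith)
  have hd0 : (0 : ℝ) ≤ (d : ℝ) + 1 := by positivity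
  nlinarith [mul_le_mul_of_nonneg_left hlog hd0]

/-- **The dyadic subsequence converges** (`{F_M(B_{2^k+1})}` is Cauchy). [cite: arXiv160201222, Thm. 15.2 (proof)] -/
theorem exists_tendsto_fM_dyadic (hd : 1 ≤ d) : ∃ L : ℝ, Tendsto (fun k : ℕ => fM d (2 ^ k + 1)) atTop (𝓝 L) := by
  set δ : ℕ → ℝ := fun k => Cke d * (((d : ℝ) + 1) * (k + 2) + (2 * d + 4)) / 2 ^ k with hδ
  have hsum : Summable δ := by
    have h1 : Summable (fun k : ℕ => (k : ℝ) ^ 1 * (1 / 2 : ℝ) ^ k) :=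
      summable_pow_mul_geometric_of_norm_lt_one 1 (by norm_num)
    have h2 : Summable (fun k : ℕ => (1 / 2 : ℝ) ^ k) := summable_geometric_of_lt_one (by norm_num) (by norm_num)
    have := (h1.mul_left (Cke d * ((d : ℝ) + 1))).add (h2.mul_left (Cke d * (((d : ℝ) + 1) * 2 + (2 * d + 4))))
    refine this.congr fun k => ?_
    simp only [hδ, pow_one, one_div, inv_pow]
    field_simp
    ring
  have hcauchy : CauchySeq (fun k : ℕ => fM d (2 ^ k + 1)) := by
    refine cauchySeq_of_dist_le_of_summable δ (fun k => ?_) hsum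
    rw [Real.dist_eq, abs_sub_comm]
    exact abs_fM_dyadic_le hd k
  exact cauchySeq_tendsto_of_complete hcauchy

/-- **Comparison with the dyadic subsequence**: for `l ≥ 3` and `k = ⌊log₂(l-1)⌋`, through the
common refinement `n = (l-1)2^k + 1`, `|f(l) - f(2^k+1)| ≤ 2C((d+1)(2k+2) + 2d + 4)/2^k`. [cite: arXiv160201222, Thm. 15.2 (proof)] -/
theorem abs_fM_sub_dyadic_le (hd : 1 ≤ d) {l : ℕ} (hl : 3 ≤ l) :
    |fM d l - fM d (2 ^ Nat.log 2 (l - 1) + 1)| ≤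
      2 * Cke d * (((d : ℝ) + 1) * (2 * Nat.log 2 (l - 1) + 2) + (2 * d + 4)) / 2 ^ Nat.log 2 (l - 1) := by
  set k := Nat.log 2 (l - 1) with hk
  have hk1 : 2 ^ k ≤ l - 1 := Nat.pow_log_le_self 2 (by omega)
  have hk2 : l - 1 < 2 ^ (k + 1) := Nat.lt_pow_succ_log_self (by norm_num) _
  have h2k : 1 ≤ 2 ^ k := Nat.one_le_two_pow
  set m := 2 ^ k + 1 with hm
  have hm2 : 2 ≤ m := by omega
  have hml : m ≤ l := by omega
  have hn1 : fineN m (l - 1) = fineN l (m - 1) := by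
    unfold fineN; rw [Nat.mul_comm]
  have e1 := abs_fM_sub_le (d := d) (m := m) (r := l - 1) hm2 (by omega)
  have e2 := abs_fM_sub_le (d := d) (m := l) (r := m - 1) (by omega) (by omega)
  rw [← hn1] at e2
  set n := fineN m (l - 1) with hn
  have hC : 0 ≤ Cke d := by unfold Cke; positivity
  have hL0 := Lc_nonneg (d := d) n
  have hmr : ((m : ℝ) - 1) = 2 ^ k := by rw [hm]; push_cast; ring
  have hlr : (2 : ℝ) ^ k ≤ (l : ℝ) - 1 := by
    have : ((2 ^ k : ℕ) : ℝ) ≤ ((l - 1 : ℕ) : ℝ) := by exact_mod_cast hk1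
    rw [Nat.cast_sub (by omega)] at this; push_cast at this; exact this
  have h2k0 : (0 : ℝ) < 2 ^ k := by positivity
  -- size of `n`: `n ≤ 2^{2k+1}`
  have hnN : 1 ≤ n := by rw [hn, fineN]; omega
  have hnle : n ≤ 2 ^ (2 * k + 1) := by
    rw [hn, fineN]
    have h1 : (l - 1) * (m - 1) ≤ (2 ^ (k + 1) - 1) * 2 ^ k := Nat.mul_le_mul (by omega) (by omega)
    have h2 : (2 ^ (k + 1) - 1) * 2 ^ k + 1 ≤ 2 ^ (2 * k + 1) := by
      have : 2 ^ (2 * k + 1) = 2 ^ (k + 1) * 2 ^ k := by rw [← pow_add]; congr 1; omega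
      rw [this, Nat.sub_mul]; have := Nat.one_le_two_pow (n := k); have := Nat.one_le_two_pow (n := k + 1)
      have : 2 ^ k ≤ 2 ^ (k + 1) * 2 ^ k := Nat.le_mul_of_pos_left _ (by positivity)
      omega
    omega
  have hlogn : Real.log n ≤ 2 * k + 2 := by
    have : (n : ℝ) ≤ 2 ^ (2 * k + 1) := by exact_mod_cast hnle
    calc Real.log n ≤ Real.log (2 ^ (2 * k + 1)) := Real.log_le_log (by exact_mod_cast hnN) this
      _ = (2 * k + 1) * Real.log 2 := by rw [Real.log_pow]; push_cast; ring
      _ ≤ (2 * k + 1) * 1 := by gcongr; have := Real.log_two_lt_d9; linarith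
      _ ≤ 2 * k + 2 := by linarith
  have hLn : Lc d n ≤ ((d : ℝ) + 1) * (2 * k + 2) + (2 * d + 4) := by
    refine (Lc_le hd hnN).trans ?_
    have hlogd : Real.log d ≤ d :=
      (Real.log_le_sub_one_of_pos (by exact_mod_cast Nat.lt_of_lt_of_le Nat.zero_lt_one hd)).trans (by linarith)
    have hd0 : (0 : ℝ) ≤ (d : ℝ) + 1 := by positivity
    nlinarith [mul_le_mul_of_nonneg_left hlogn hd0]
  -- the two errors
  have t1 : |fM d n - fM d m| ≤ Cke d * Lc d n / 2 ^ k := by rw [← hmr]; exact e1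
  have t2 : |fM d n - fM d l| ≤ Cke d * Lc d n / 2 ^ k := by
    refine e2.trans ?_
    exact div_le_div_of_nonneg_left (by positivity) h2k0 hlr
  calc |fM d l - fM d m| ≤ |fM d n - fM d m| + |fM d n - fM d l| := by
        have := abs_sub_abs_le_abs_sub (fM d n - fM d m) (fM d n - fM d l)
        rw [abs_sub_comm (fM d l)]
        calc |fM d m - fM d l| = |(fM d n - fM d l) - (fM d n - fM d m)| := by ring_nf
          _ ≤ |fM d n - fM d l| + |fM d n - fM d m| := abs_sub _ _
          _ = _ := add_comm _ _
    _ ≤ Cke d * Lc d n / 2 ^ k + Cke d * Lc d n / 2 ^ k := add_le_add t1 t2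
    _ = 2 * Cke d * Lc d n / 2 ^ k := by ring
    _ ≤ 2 * Cke d * (((d : ℝ) + 1) * (2 * k + 2) + (2 * d + 4)) / 2 ^ k := by gcongr

/-- **Theorem 15.2 (the infinite-volume limit of lattice Maxwell theory)**: the free energy per
site `log Z_M(B_n)/n^d` of the axial-gauge lattice Maxwell theory on the cube `B_n` converges as
`n → ∞` (to a limit depending only on `d`). Proof: exact Gaussian elimination of the block interiors
at fixed block-boundary values (`ZM_fine_eq`, replacing the printed restricted partition functions),
the consistency estimate `abs_fM_sub_le` along divisibility chains `n = r(m-1)+1`, the Cauchy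
property of the dyadic subsequence `2^k+1` and the common refinement `(l-1)2^k+1`. [cite: arXiv160201222, Thm. 15.2] -/
theorem tendsto_logZM_div (hd : 1 ≤ d) : ∃ L : ℝ, Tendsto (fun n : ℕ => logZM d n / (n : ℝ) ^ d) atTop (𝓝 L) := by
  obtain ⟨L, hL⟩ := exists_tendsto_fM_dyadic (d := d) hd
  refine ⟨L, ?_⟩
  show Tendsto (fM d) atTop (𝓝 L)
  set ε : ℕ → ℝ := fun k => 2 * Cke d * (((d : ℝ) + 1) * (2 * k + 2) + (2 * d + 4)) / 2 ^ k with hεdef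
  have hε : Tendsto ε atTop (𝓝 0) := by
    have h1s : Summable (fun k : ℕ => (k : ℝ) ^ 1 * (1 / 2 : ℝ) ^ k) :=
      summable_pow_mul_geometric_of_norm_lt_one 1 (by norm_num)
    have h1 : Tendsto (fun k : ℕ => (k : ℝ) ^ 1 * (1 / 2 : ℝ) ^ k) atTop (𝓝 0) := h1s.tendsto_atTop_zero
    have h2 : Tendsto (fun k : ℕ => (1 / 2 : ℝ) ^ k) atTop (𝓝 0) :=
      tendsto_pow_atTop_nhds_zero_of_lt_one (by norm_num) (by norm_num)
    have := (h1.const_mul (4 * Cke d * ((d : ℝ) + 1))).add (h2.const_mul (2 * Cke d * (2 * ((d : ℝ) + 1) + (2 * d + 4))))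
    rw [mul_zero, mul_zero, add_zero] at this
    refine this.congr fun k => ?_
    simp only [hεdef, pow_one, one_div, inv_pow]
    field_simp
    ring
  rw [Metric.tendsto_atTop]
  intro e he
  obtain ⟨K₁, hK₁⟩ := (Metric.tendsto_atTop.1 hL) (e / 2) (half_pos he)
  obtain ⟨K₂, hK₂⟩ := (Metric.tendsto_atTop.1 hε) (e / 2) (half_pos he)
  refine ⟨2 ^ (max K₁ K₂) + 3, fun l hl => ?_⟩
  have hKpow : 1 ≤ 2 ^ (max K₁ K₂) := Nat.one_le_two_pow
  have hl3 : 3 ≤ l := by omega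
  set k := Nat.log 2 (l - 1) with hk
  have hk : max K₁ K₂ ≤ k := Nat.le_log_of_pow_le (by norm_num) (by omega)
  have h1 := abs_fM_sub_dyadic_le (d := d) hd hl3
  have h2 := hK₁ k (le_trans (le_max_left _ _) hk)
  have h3 := hK₂ k (le_trans (le_max_right _ _) hk)
  rw [Real.dist_eq] at h2 h3 ⊢
  rw [sub_zero] at h3
  have h1' : |fM d l - fM d (2 ^ k + 1)| < e / 2 := lt_of_le_of_lt (h1.trans (le_abs_self _)) h3
  calc |fM d l - L| = |(fM d l - fM d (2 ^ k + 1)) + (fM d (2 ^ k + 1) - L)| := by ring_nf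
    _ ≤ |fM d l - fM d (2 ^ k + 1)| + |fM d (2 ^ k + 1) - L| := abs_add_le _ _
    _ < e / 2 + e / 2 := add_lt_add h1' h2
    _ = e := by ring

end Limit

end LatticeMaxwell

end Literature.MathematicalPhysics.QuantumFieldTheory
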